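import Literature.Analysis.DeBrangesSpaces.BurnolSonineLemma2Proofs
import Literature.NumberTheory.LFunctions.BurnolFourierZetaSonine
import Literature.NumberTheory.LFunctions.BurnolTailFactor
import Literature.Analysis.Fourier.L2FourierDilation
import Literature.Analysis.Fourier.L2FourierMultiplication
import Literature.Analysis.FunctionSpaces.HardyInequalityAverage
import HarnessLib

/-!
# Burnol 2004 (JTNB), Prop. 4.6: `⋃_{b>a} K_b` is dense in `K_a` and `⋃_{b>a} L_b` is dense in `L_a`,
# Prop. 4.5: `dim (L_a/K_a) = 2`, and Lemma 4.4: `F ∈ K̂_a ⇒ F(s)/s ∈ L̂_a` — DISCHARGES of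
# `Burnol2004b_prop4_6`, `Burnol2004b_prop4_5` and `Burnol2004b_lemma4_4`

LINE 1 — LABEL: RH-FREE (a Hilbert-space lattice argument about the Sonine chains `K_a ⊂ L_a ⊂ L²`;
the Riemann zeta function does not occur). FRAMING (cell rh-crit, D-0074): corpus theorems are RH-FREE
literature; nothing here is worded as progress toward RH. bears_on: B-C/B-P (LADDER-RH COLUMN 6, de
Branges framework). WHAT THIS IS NOT: not a route, not a criterion; the continuity of the Sonine chain in
the parameter `a` is structure of a corpus, it does not move RH. Nothing here bears on the truth of RH.

Source: J.-F. Burnol, *Two complete and minimal systems associated with the zeros of the Riemann zeta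
function*, J. Théor. Nombres Bordeaux **16** (2004) 65–94 = arXiv:math/0203120v7 [Burnol2004b], Prop. 4.6
(TeX of record `dbl/src/Burnol2004JTNB_arXivmath0203120v7.tex` l.790–804), typed by dbl-t14 in
`BurnolZetaSystemsHardy.lean` as the named fact `Burnol2004b_prop4_6`.

## The printed proof (followed)

"Generally speaking `⋂_{b>a}(A_b + B_b) = (⋂_{b>a} A_b) + (⋂_{b>a} B_b)` when we have vector spaces
indexed by `b > a` with `A_{b₁} ⊂ A_{b₂}` and `B_{b₁} ⊂ B_{b₂}` for `b₁ < b₂` and `A_b ∩ B_b = {0}` for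
`b > a`. We apply this to `A_b = L²(0,b;dt)` and `B_b = 𝓕₊(L²(0,b;dt))`, as `K_a = (A_a+B_a)^⊥`,
`A_a = ⋂_{b>a} A_b`, `B_a = ⋂_{b>a} B_b`, and `A_a + B_a` is closed" (TeX l.796–804); for `L_a` the same
with the codimension-one subspaces "`L²(0,a) ∩ 𝟙^⊥_{0<t<a}`", "`L_a` is the perpendicular complement to
`(L²(0,a) ∩ 𝟙^⊥) + 𝓕₊(L²(0,a) ∩ 𝟙^⊥)`" (second proof of Prop. 4.5, TeX l.779–785).

In the tree's `L²(ℝ)` model (`K_a = sonineK a`, `L_a = sonineL a`, even classes `evenL2 = evenPart`,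
cosine transform = Mathlib's `L²` Fourier transform `𝓕`): `A_b = ran P_b` (`P_b = cutoffProj b`,
multiplication by `𝟙_{[−b,b]}`), `B_b = ran P̃_b` (`P̃_b = cutoffProjHat b = 𝓕⁻¹P_b𝓕`); the two analytic
inputs are KERNEL THEOREMS of the Connes–Consani files: `A_b + B_b` is closed
(`isClosed_range_cutoffProj_sup_range_cutoffProjHat`, from `‖P_bP̃_b‖ < 1`) and `A_b ∩ B_b = {0}`
(`range_cutoffProj_inf_range_cutoffProjHat`, a time- and band-limited function vanishes). The passage
from `L²(0,∞)` to even functions on `ℝ` is the symmetrisation `v ↦ v + v(−·)` (as in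
`BurnolSonineDensityProofs.lean`): for `t` even and `v ⊥ (A_b + B_b)` one has `⟨v,t⟩ = ½⟨v + Rv, t⟩` with
`v + Rv ∈ K_b`. The engine `subset_closure_iUnion_of_chain` below runs the printed argument once for an
abstract pair of chains `A_b ≤ ran P_b`, `B_b ≤ ran P̃_b`; the two clauses are its instances
(`A'_b = ran P_b ∩ (ℂ𝟙_{[−b,b]})^⊥` for `L`).

## What is PROVED (theorem-only module: no definition, no named fact)

* `sonineK_subset_closure_iUnion`, `sonineL_subset_closure_iUnion` (the two clauses of Prop. 4.6);
* `Burnol2004b_prop4_6_holds : Burnol2004b_prop4_6`;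
* `exists_pair_sonineL_mod_sonineK` and `Burnol2004b_prop4_5_holds : Burnol2004b_prop4_5` (§H: the
  SECOND printed proof of Prop. 4.5, TeX l.779–786 — "`L_a` is the perpendicular complement to
  `(L²(0,a) ∩ 𝟙^⊥) + 𝓕₊(L²(0,a) ∩ 𝟙^⊥)` … this imposes two additional conditions": with
  `W = ran P_a ⊔ ran P̃_a`, `W' = (ran P_a ⊓ (ℂχ_a)ᗮ) ⊔ (ran P̃_a ⊓ (ℂ𝓕⁻¹χ_a)ᗮ)` one has
  `K_a = even ∩ Wᗮ`, `L_a = even ∩ W'ᗮ`, and the components `u, v` of `χ_a, 𝓕⁻¹χ_a` orthogonal to `W'`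
  are even, independent modulo `K_a` by uniqueness in `ran P_a ⊕ ran P̃_a`, and span `L_a` modulo `K_a`.
  DEVIATION: the paper's first proof (via `𝓕₊(𝟙_{t>a} t^{−w})` and Thm. 4.2) is not followed.)
* `exists_cesaro_mem_sonineL` and `Burnol2004b_lemma4_4_holds : Burnol2004b_lemma4_4` (Part 2: for
  `f ∈ K_a` the CESÀRO AVERAGE `h = Qf`, `(Qf)(t) = |t|⁻¹∫₀^{|t|} f = ∫₀¹ f(vt) dv`, lies in `L_a` with
  `ĥ(s) = f̂(s)/s`: `h ∈ L²` by Hardy's inequality [HardyLittlewoodPolya1952, Thm. 327] (tree: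
  `HardyInequalityAverage.lean`), `ĥ = f̂/s` by Fubini (`rightMellin_cesaro`), and the `𝓕`-side
  condition "`𝓕h` constant on `(0,a)`" in the duality form `⟨𝓕⁻¹α, Qf⟩ = 0` for mean-zero `α`
  supported in `[−a,a]` (`inner_fourierInv_cesaro_eq_zero`: Parseval, the `L²` dilation law
  `𝓕(f(v·)) = v⁻¹(𝓕f)(·/v)` of `L2FourierDilation.lean`, two Fubini exchanges and the substitution
  `∫₀¹ v⁻¹g(ξ/v)dv = ∫_{|ξ|}^∞ g(η)dη/η`, whose value is the constant `∫_a^∞ g dη/η` on `[−a,a]`).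
  The printed proof is one line ("`F(s)/s` is regular at `0`", via Prop. 4.1/4.3 — the Hardy-space
  road); DEVIATION: the elementary `t`-side witness is used instead, so that no Hardy-space
  characterisation (`Burnol2004b_prop4_1R`) is needed.)
* `rightMellin_cesaro_cpow` (§V, tool for Prop. 4.3's division by `s − w`: the TWISTED Cesàro average
  `(Q_w k)(t) = ∫₀¹ v^{−w}k(vt)dv` has `(Q_w k)^(s) = k̂(s)/(s − w)` on `Re s > max(½, Re w)`; no fact is
  discharged by it — the `𝓕`-side and the `L²` bound for `Q_w` are NOT in this file).

## References
* [Burnol2004b] J.-F. Burnol, J. Théor. Nombres Bordeaux 16 (2004) 65–94, Prop. 4.5 (second proof) and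
  Prop. 4.6 (TeX l.760–804).
* [Burnol2004] J.-F. Burnol, Forum Math. 16 (2004), §6 (closedness of `L²(0,λ) + 𝓕₊L²(0,λ)`).
-/

noncomputable section

open _root_.MeasureTheory _root_.Set _root_.Filter FourierTransform
open scoped Topology InnerProductSpace ENNReal
open Literature.NumberTheory.ConnesConsani2021 (cutoffProj cutoffProjHat cutoffProj_coeFn
  cutoffProjHat_apply isStarProjection_cutoffProj isStarProjection_cutoffProjHat compNeg_cutoffProj
  compNeg_cutoffProjHat isClosed_range_cutoffProj_sup_range_cutoffProjHat
  range_cutoffProj_inf_range_cutoffProjHat norm_cutoffProj_comp_cutoffProjHat_lt_one evenPart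
  mem_evenPart_iff isClosed_evenPart)
open Literature.Analysis.DeBrangesSpaces.Burnol2002 (mem_sonineK_iff_cutoffProj)
open Literature.Analysis.Fourier (coeFn_compNeg compNeg_compNeg fourier_compNeg inner_fourier_right
  fourierInv_eq_compNeg_fourier memLp_comp_mul_left coeFn_toLp_comp_mul_left fourier_toLp_comp_mul_left
  measurePreserving_mul_left)

namespace Literature.NumberTheory.LFunctions

/-! ### A. Abstract Hilbert-space lemmas (star projections, quasi-orthogonal sums) -/

section Abstract

variable {E : Type*} [NormedAddCommGroup E] [InnerProductSpace ℂ E] [CompleteSpace E]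

omit [CompleteSpace E] in
/-- `x ∈ ran P ↔ P x = x` for an idempotent `P`. [folklore] -/
private theorem mem_range_iff_apply_eq {P : E →L[ℂ] E} (hP : IsIdempotentElem P) {x : E} :
    x ∈ P.range ↔ P x = x := by
  constructor
  · rintro ⟨y, rfl⟩
    exact congrArg (fun R : E →L[ℂ] E ↦ R y) hP.eq
  · intro h
    exact ⟨x, h⟩

/-- For a star projection `P` and `z ⊥ ran P`: `P z = 0`. [folklore] -/
private theorem apply_eq_zero_of_mem_orthogonal_range {P : E →L[ℂ] E} (hP : IsStarProjection P)
    {z : E} (hz : z ∈ P.rangeᗮ) : P z = 0 := by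
  have hPs := hP.isSelfAdjoint.isSymmetric
  have h1 : ⟪P z, z⟫_ℂ = 0 :=
    Submodule.inner_right_of_mem_orthogonal (LinearMap.mem_range_self (P : E →ₗ[ℂ] E) z) hz
  have h2 : ⟪P z, P z⟫_ℂ = ⟪P z, z⟫_ℂ := by
    have h3 : P (P z) = P z := congrArg (fun R : E →L[ℂ] E ↦ R z) hP.isIdempotentElem.eq
    calc ⟪P z, P z⟫_ℂ = ⟪P (P z), z⟫_ℂ := (hPs (P z) z).symm
      _ = ⟪P z, z⟫_ℂ := by rw [h3]
  rw [h1] at h2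
  exact inner_self_eq_zero.1 h2

/-- For a star projection `P` with `P z = 0`: `z ⊥ ran P`. [folklore] -/
private theorem mem_orthogonal_range_of_apply_eq_zero {P : E →L[ℂ] E} (hP : IsStarProjection P)
    {z : E} (hz : P z = 0) : z ∈ P.rangeᗮ := by
  rw [Submodule.mem_orthogonal]
  rintro u ⟨w, rfl⟩
  have hPs := hP.isSelfAdjoint.isSymmetric
  calc ⟪P w, z⟫_ℂ = ⟪w, P z⟫_ℂ := hPs w z
    _ = 0 := by rw [hz, inner_zero_right]

/-- **Quasi-orthogonality of two ranges**: for star projections `P, Q`, `α ∈ ran P`, `β ∈ ran Q`: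
`|⟨α, β⟩| ≤ ‖PQ‖·‖α‖‖β‖`. [cite: Burnol2004, §6 (the operator `P_λ𝓕₊P_λ`, arXiv p. 22)] -/
private theorem norm_inner_le_of_mem_range {P Q : E →L[ℂ] E} (hP : IsStarProjection P)
    (hQ : IsStarProjection Q) {α β : E} (hα : α ∈ P.range) (hβ : β ∈ Q.range) :
    ‖⟪α, β⟫_ℂ‖ ≤ ‖P ∘L Q‖ * ‖α‖ * ‖β‖ := by
  have hPs := hP.isSelfAdjoint.isSymmetric
  have hα' : P α = α := (mem_range_iff_apply_eq hP.isIdempotentElem).1 hα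
  have hβ' : Q β = β := (mem_range_iff_apply_eq hQ.isIdempotentElem).1 hβ
  have h : ⟪α, β⟫_ℂ = ⟪α, (P ∘L Q) β⟫_ℂ := by
    rw [ContinuousLinearMap.comp_apply, hβ']
    calc ⟪α, β⟫_ℂ = ⟪P α, β⟫_ℂ := by rw [hα']
      _ = ⟪α, P β⟫_ℂ := hPs α β
  rw [h]
  calc ‖⟪α, (P ∘L Q) β⟫_ℂ‖ ≤ ‖α‖ * ‖(P ∘L Q) β‖ := norm_inner_le_norm _ _
    _ ≤ ‖α‖ * (‖P ∘L Q‖ * ‖β‖) := by gcongr; exact ContinuousLinearMap.le_opNorm _ _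
    _ = ‖P ∘L Q‖ * ‖α‖ * ‖β‖ := by ring

omit [CompleteSpace E] in
/-- If `|⟨a,b⟩| ≤ c‖a‖‖b‖` with `0 ≤ c` then `(1 − c)(‖a‖² + ‖b‖²) ≤ ‖a + b‖²`. [folklore] -/
private theorem sq_add_sq_le_of_inner_le (a b : E) {c : ℝ} (hc0 : 0 ≤ c)
    (h : ‖⟪a, b⟫_ℂ‖ ≤ c * ‖a‖ * ‖b‖) : (1 - c) * (‖a‖ ^ 2 + ‖b‖ ^ 2) ≤ ‖a + b‖ ^ 2 := by
  rw [norm_add_sq (𝕜 := ℂ) a b]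
  have hre : -(c * ‖a‖ * ‖b‖) ≤ RCLike.re ⟪a, b⟫_ℂ := by
    have h1 : |RCLike.re ⟪a, b⟫_ℂ| ≤ ‖⟪a, b⟫_ℂ‖ := RCLike.abs_re_le_norm ⟪a, b⟫_ℂ
    have h2 : -|RCLike.re ⟪a, b⟫_ℂ| ≤ RCLike.re ⟪a, b⟫_ℂ := neg_abs_le (RCLike.re ⟪a, b⟫_ℂ)
    linarith
  have h3 : 2 * (c * ‖a‖ * ‖b‖) ≤ c * (‖a‖ ^ 2 + ‖b‖ ^ 2) := by
    have h4 : 2 * ‖a‖ * ‖b‖ ≤ ‖a‖ ^ 2 + ‖b‖ ^ 2 := two_mul_le_add_sq ‖a‖ ‖b‖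
    have h5 := mul_le_mul_of_nonneg_left h4 hc0
    linarith
  linarith

/-- **Closed sums inside a quasi-orthogonal pair of ranges.** If `P, Q` are star projections with
`‖PQ‖ < 1` and `A ≤ ran P`, `B ≤ ran Q` are closed subspaces, then `A + B` is closed (Cauchy sequences
of the components). [cite: Burnol2004b, proof of Prop. 4.5 ("the closed space `L²(0,a)+𝓕₊(L²(0,a))`", TeX l.779–785)] -/
private theorem isClosed_sup_of_le_range {P Q : E →L[ℂ] E} (hP : IsStarProjection P)
    (hQ : IsStarProjection Q) (hPQ : ‖P ∘L Q‖ < 1) {A B : Submodule ℂ E} (hA : A ≤ P.range)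
    (hB : B ≤ Q.range) (hAc : IsClosed (A : Set E)) (hBc : IsClosed (B : Set E)) :
    IsClosed ((A ⊔ B : Submodule ℂ E) : Set E) := by
  set c : ℝ := ‖P ∘L Q‖ with hc
  have hc0 : 0 ≤ c := norm_nonneg _
  have hc1 : 0 < 1 - c := by linarith
  -- the component bound
  have hbound : ∀ α ∈ A, ∀ β ∈ B, (1 - c) * ‖α‖ ^ 2 ≤ ‖α + β‖ ^ 2 := by
    intro α hα β hβ
    have h := sq_add_sq_le_of_inner_le α β hc0 (norm_inner_le_of_mem_range hP hQ (hA hα) (hB hβ))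
    nlinarith [sq_nonneg ‖β‖]
  refine IsSeqClosed.isClosed fun u x hu hux ↦ ?_
  -- components of the sequence
  have hdec : ∀ n, ∃ α ∈ A, ∃ β ∈ B, α + β = u n := fun n ↦ Submodule.mem_sup.1 (hu n)
  choose α hαA β hβB hαβ using hdec
  -- `α` is Cauchy
  have hαC : CauchySeq α := by
    rw [Metric.cauchySeq_iff]
    intro ε hε
    have hux' : CauchySeq u := hux.cauchySeq
    rw [Metric.cauchySeq_iff] at hux'
    obtain ⟨N, hN⟩ := hux' (ε * Real.sqrt (1 - c)) (by positivity)
    refine ⟨N, fun m hm n hn ↦ ?_⟩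
    have h1 := hN m hm n hn
    rw [dist_eq_norm] at h1 ⊢
    have h2 : (1 - c) * ‖α m - α n‖ ^ 2 ≤ ‖(α m - α n) + (β m - β n)‖ ^ 2 :=
      hbound _ (A.sub_mem (hαA m) (hαA n)) _ (B.sub_mem (hβB m) (hβB n))
    have h3 : (α m - α n) + (β m - β n) = u m - u n := by rw [← hαβ m, ← hαβ n]; abel
    rw [h3] at h2
    have h4 : ‖u m - u n‖ ^ 2 < (ε * Real.sqrt (1 - c)) ^ 2 := by
      exact pow_lt_pow_left₀ h1 (norm_nonneg _) two_ne_zero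
    have h5 : (ε * Real.sqrt (1 - c)) ^ 2 = ε ^ 2 * (1 - c) := by
      rw [mul_pow, Real.sq_sqrt hc1.le]
    have h6 : (1 - c) * ‖α m - α n‖ ^ 2 < (1 - c) * ε ^ 2 := by nlinarith
    have h7 : ‖α m - α n‖ ^ 2 < ε ^ 2 := lt_of_mul_lt_mul_left h6 hc1.le
    exact lt_of_pow_lt_pow_left₀ 2 hε.le h7
  obtain ⟨α₀, hα₀⟩ := cauchySeq_tendsto_of_complete hαC
  have hα₀A : α₀ ∈ A := hAc.mem_of_tendsto hα₀ (Eventually.of_forall hαA)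
  -- `β = u − α` converges to `x − α₀ ∈ B`
  have hβ : Tendsto β atTop (𝓝 (x - α₀)) := by
    have : β = fun n ↦ u n - α n := by
      funext n; rw [← hαβ n]; abel
    rw [this]
    exact hux.sub hα₀
  have hβ₀B : x - α₀ ∈ B := hBc.mem_of_tendsto hβ (Eventually.of_forall hβB)
  have hx : x = α₀ + (x - α₀) := by abel
  rw [SetLike.mem_coe, hx]
  exact Submodule.add_mem_sup hα₀A hβ₀B

omit [CompleteSpace E] in
/-- Uniqueness of decompositions in a direct sum: `A ⊓ B = ⊥`, `α₁ + β₁ = α₂ + β₂` ⇒ `α₁ = α₂`.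
[folklore] -/
private theorem eq_of_add_eq_add_of_inf_eq_bot {A B : Submodule ℂ E} (hAB : A ⊓ B = ⊥) {α₁ α₂ β₁ β₂ : E}
    (hα₁ : α₁ ∈ A) (hα₂ : α₂ ∈ A) (hβ₁ : β₁ ∈ B) (hβ₂ : β₂ ∈ B) (h : α₁ + β₁ = α₂ + β₂) :
    α₁ = α₂ := by
  have h1 : α₁ - α₂ = β₂ - β₁ := by
    rw [sub_eq_iff_eq_add, add_comm, ← add_sub_assoc, eq_sub_iff_add_eq]; exact h
  have hA : α₁ - α₂ ∈ A := A.sub_mem hα₁ hα₂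
  have hB : α₁ - α₂ ∈ B := by rw [h1]; exact B.sub_mem hβ₂ hβ₁
  have h0 : α₁ - α₂ ∈ A ⊓ B := Submodule.mem_inf.2 ⟨hA, hB⟩
  rw [hAB, Submodule.mem_bot] at h0
  exact sub_eq_zero.1 h0

end Abstract

/-! ### B. The cutoff pair `P_b`, `P̃_b` on `L²(ℝ)`: ranges, monotonicity, intersections over `b` -/

section Cutoff

/-- `P_b x = x` iff `x` vanishes a.e. off `[−b,b]`. [folklore] -/
private theorem cutoffProj_apply_eq_self_iff {b : ℝ} {x : Lp ℂ 2 (volume : Measure ℝ)} :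
    cutoffProj b x = x ↔ ∀ᵐ t : ℝ, t ∉ Icc (-b) b → (x : ℝ → ℂ) t = 0 := by
  have hP := cutoffProj_coeFn b x
  constructor
  · intro h
    rw [h] at hP
    filter_upwards [hP] with t ht hts
    rw [ht, Set.indicator_of_notMem hts]
  · intro h
    apply Lp.ext
    filter_upwards [hP, h] with t ht hz
    rw [ht]
    by_cases hts : t ∈ Icc (-b) b
    · rw [Set.indicator_of_mem hts]
    · rw [Set.indicator_of_notMem hts, hz hts]

/-- `x ∈ ran P_b` iff `x` vanishes a.e. off `[−b,b]`. [folklore] -/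
private theorem mem_range_cutoffProj_iff {b : ℝ} {x : Lp ℂ 2 (volume : Measure ℝ)} :
    x ∈ (cutoffProj b).range ↔ ∀ᵐ t : ℝ, t ∉ Icc (-b) b → (x : ℝ → ℂ) t = 0 := by
  rw [mem_range_iff_apply_eq (isStarProjection_cutoffProj b).isIdempotentElem,
    cutoffProj_apply_eq_self_iff]

/-- `x ∈ ran P̃_b ↔ 𝓕x ∈ ran P_b` (`P̃_b = 𝓕⁻¹P_b𝓕`). [folklore] -/
private theorem mem_range_cutoffProjHat_iff {b : ℝ} {x : Lp ℂ 2 (volume : Measure ℝ)} :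
    x ∈ (cutoffProjHat b).range ↔ (𝓕 x : Lp ℂ 2 (volume : Measure ℝ)) ∈ (cutoffProj b).range := by
  rw [mem_range_iff_apply_eq (isStarProjection_cutoffProjHat b).isIdempotentElem,
    mem_range_iff_apply_eq (isStarProjection_cutoffProj b).isIdempotentElem, cutoffProjHat_apply]
  constructor
  · intro h
    have h' := congrArg (fun u : Lp ℂ 2 (volume : Measure ℝ) ↦ (𝓕 u : Lp ℂ 2 (volume : Measure ℝ))) h
    simpa only [fourier_fourierInv_eq] using h'
  · intro h
    rw [h, fourierInv_fourier_eq]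

/-- The ranges `ran P_b` increase with `b`. [folklore] -/
private theorem range_cutoffProj_mono {b₁ b₂ : ℝ} (h : b₁ ≤ b₂) :
    (cutoffProj b₁).range ≤ (cutoffProj b₂).range := by
  intro x hx
  rw [mem_range_cutoffProj_iff] at hx ⊢
  filter_upwards [hx] with t ht hts
  exact ht fun hm ↦ hts ⟨by linarith [hm.1], hm.2.trans h⟩

/-- The ranges `ran P̃_b` increase with `b`. [folklore] -/
private theorem range_cutoffProjHat_mono {b₁ b₂ : ℝ} (h : b₁ ≤ b₂) :
    (cutoffProjHat b₁).range ≤ (cutoffProjHat b₂).range := by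
  intro x hx
  rw [mem_range_cutoffProjHat_iff] at hx ⊢
  exact range_cutoffProj_mono h hx

/-- `⋂_{b>a} ran P_b = ran P_a` (sequential form: `b = a + 1/(n+1)`). [cite: Burnol2004b, proof of Prop. 4.6 ("`A_a = ⋂_{b>a} A_b`", TeX l.800–802)] -/
private theorem mem_range_cutoffProj_of_forall {a : ℝ} {x : Lp ℂ 2 (volume : Measure ℝ)}
    (h : ∀ n : ℕ, x ∈ (cutoffProj (a + 1 / ((n : ℝ) + 1))).range) : x ∈ (cutoffProj a).range := by
  rw [mem_range_cutoffProj_iff]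
  have h' : ∀ n : ℕ, ∀ᵐ t : ℝ, t ∉ Icc (-(a + 1 / ((n : ℝ) + 1))) (a + 1 / ((n : ℝ) + 1)) →
      (x : ℝ → ℂ) t = 0 := fun n ↦ mem_range_cutoffProj_iff.1 (h n)
  filter_upwards [ae_all_iff.2 h'] with t ht hta
  -- `|t| > a`: some `n` with `|t| > a + 1/(n+1)`
  have hta' : a < |t| := by
    by_contra hle
    exact hta (abs_le.1 (not_lt.1 hle) |> fun h ↦ ⟨by linarith [h.1], h.2⟩)
  obtain ⟨n, hn⟩ := exists_nat_one_div_lt (sub_pos.2 hta')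
  refine ht n fun hm ↦ ?_
  have : |t| ≤ a + 1 / ((n : ℝ) + 1) := abs_le.2 ⟨by linarith [hm.1], hm.2⟩
  linarith

/-- The indicator class `𝟙_{[−b,b]} ∈ L²(ℝ)` lies in `ran P_b`. [folklore] -/
private theorem indicatorConstLp_mem_range_cutoffProj (b : ℝ) :
    indicatorConstLp 2 (measurableSet_Icc : MeasurableSet (Icc (-b) b)) measure_Icc_lt_top.ne (1 : ℂ)
      ∈ (cutoffProj b).range := by
  rw [mem_range_cutoffProj_iff]
  filter_upwards [indicatorConstLp_coeFn (p := 2) (hs := (measurableSet_Icc : MeasurableSet (Icc (-b) b)))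
    (hμs := measure_Icc_lt_top.ne) (c := (1 : ℂ))] with t ht hts
  rw [ht, Set.indicator_of_notMem hts]

/-- `⟨𝟙_{[−b,b]}, α⟩ = ∫ α` for `α` vanishing a.e. off `[−a,a] ⊆ [−b,b]`. [folklore] -/
private theorem inner_indicatorConstLp_eq_integral {a b : ℝ} (hab : a ≤ b)
    {α : Lp ℂ 2 (volume : Measure ℝ)} (hα : α ∈ (cutoffProj a).range) :
    ⟪indicatorConstLp 2 (measurableSet_Icc : MeasurableSet (Icc (-b) b)) measure_Icc_lt_top.ne (1 : ℂ),
      α⟫_ℂ = ∫ t, (α : ℝ → ℂ) t := by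
  rw [mem_range_cutoffProj_iff] at hα
  rw [L2.inner_def]
  refine integral_congr_ae ?_
  filter_upwards [hα, indicatorConstLp_coeFn (p := 2)
    (hs := (measurableSet_Icc : MeasurableSet (Icc (-b) b))) (hμs := measure_Icc_lt_top.ne)
    (c := (1 : ℂ))] with t hz ht
  rw [RCLike.inner_apply, ht]
  by_cases htb : t ∈ Icc (-b) b
  · rw [Set.indicator_of_mem htb, map_one, mul_one]
  · rw [Set.indicator_of_notMem htb, map_zero, hz fun hta ↦ htb ⟨by linarith [hta.1], hta.2.trans hab⟩,
      mul_zero]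

end Cutoff

/-! ### C. Symmetrisation: even classes and the reflection `R` -/

section Reflection

/-- For an even `t`, `⟨Rv, t⟩ = ⟨v, t⟩`. [folklore] -/
private theorem inner_compNeg_left_of_mem_evenPart (v : Lp ℂ 2 (volume : Measure ℝ))
    {t : Lp ℂ 2 (volume : Measure ℝ)} (ht : t ∈ evenPart) :
    ⟪Lp.compMeasurePreserving (fun x : ℝ ↦ -x) (Measure.measurePreserving_neg (volume : Measure ℝ)) v,
      t⟫_ℂ = ⟪v, t⟫_ℂ := by
  have ht' : ∀ᵐ x : ℝ, (t : ℝ → ℂ) (-x) = (t : ℝ → ℂ) x := ht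
  rw [L2.inner_def, L2.inner_def]
  have h1 := coeFn_compNeg (F := ℂ) v
  calc ∫ x, ⟪(Lp.compMeasurePreserving (fun x : ℝ ↦ -x)
          (Measure.measurePreserving_neg (volume : Measure ℝ)) v : ℝ → ℂ) x, (t : ℝ → ℂ) x⟫_ℂ
      = ∫ x, ⟪(v : ℝ → ℂ) (-x), (t : ℝ → ℂ) (-x)⟫_ℂ := by
        refine integral_congr_ae ?_
        filter_upwards [h1, ht'] with x hx htx
        rw [hx, htx]
    _ = ∫ x, ⟪(v : ℝ → ℂ) x, (t : ℝ → ℂ) x⟫_ℂ :=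
        (Measure.measurePreserving_neg (volume : Measure ℝ)).integral_comp
          (Homeomorph.neg ℝ).measurableEmbedding (fun x ↦ ⟪(v : ℝ → ℂ) x, (t : ℝ → ℂ) x⟫_ℂ)

/-- `v + Rv` is even. [folklore] -/
private theorem add_compNeg_mem_evenPart (v : Lp ℂ 2 (volume : Measure ℝ)) :
    v + Lp.compMeasurePreserving (fun x : ℝ ↦ -x) (Measure.measurePreserving_neg (volume : Measure ℝ)) v
      ∈ evenPart := by
  have hneg : Measure.QuasiMeasurePreserving (fun x : ℝ ↦ -x) volume volume :=
    (Measure.measurePreserving_neg (volume : Measure ℝ)).quasiMeasurePreserving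
  have hR := coeFn_compNeg (F := ℂ) v
  have hadd := Lp.coeFn_add v (Lp.compMeasurePreserving (fun x : ℝ ↦ -x)
    (Measure.measurePreserving_neg (volume : Measure ℝ)) v)
  rw [mem_evenPart_iff]
  filter_upwards [hadd, hneg.ae hadd, hR, hneg.ae hR] with x ha ha' hb hb'
  rw [ha', ha, Pi.add_apply, Pi.add_apply, hb, hb', neg_neg, add_comm]

/-- **Orthogonality transfer by symmetrisation.** Let `W` be a subspace whose orthogonal complement is
stable under the reflection `R`, and let `t` be even and orthogonal to `evenPart ⊓ Wᗮ`. Then `t ⊥ Wᗮ`,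
i.e. `t ∈ Wᗮᗮ`. [cite: Burnol2004b, proof of Prop. 4.5/4.6 (the passage `L²(0,∞) ↔` even functions, TeX l.779–804)] -/
private theorem mem_orthogonal_orthogonal_of_even {W : Submodule ℂ (Lp ℂ 2 (volume : Measure ℝ))}
    (hW : ∀ v ∈ Wᗮ, Lp.compMeasurePreserving (fun x : ℝ ↦ -x)
      (Measure.measurePreserving_neg (volume : Measure ℝ)) v ∈ Wᗮ)
    {t : Lp ℂ 2 (volume : Measure ℝ)} (ht : t ∈ evenPart)
    (hK : ∀ k ∈ evenPart ⊓ Wᗮ, ⟪k, t⟫_ℂ = 0) : t ∈ Wᗮᗮ := by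
  rw [Submodule.mem_orthogonal]
  intro v hv
  have hmem : v + Lp.compMeasurePreserving (fun x : ℝ ↦ -x)
      (Measure.measurePreserving_neg (volume : Measure ℝ)) v ∈ evenPart ⊓ Wᗮ :=
    Submodule.mem_inf.2 ⟨add_compNeg_mem_evenPart v, Wᗮ.add_mem hv (hW v hv)⟩
  have h := hK _ hmem
  rw [inner_add_left, inner_compNeg_left_of_mem_evenPart v ht, ← two_mul] at h
  exact (mul_eq_zero.1 h).resolve_left two_ne_zero

end Reflection

/-! ### D. The engine: density of a decreasing chain `evenPart ⊓ (A_b ⊔ B_b)ᗮ` at `b = a` -/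

section Engine

/-- **The lattice argument of Prop. 4.6.** Let `A_b ≤ ran P_b`, `B_b ≤ ran P̃_b` (`b ∈ ℝ`) be subspaces
of `L²(ℝ)` with `A_b ⊔ B_b` closed, with orthogonal complements stable under the reflection, increasing
in `b`, and with `⋂_{a<b≤a+1} A_b ⊆ A_a`, `⋂_{a<b≤a+1} B_b ⊆ B_a`. Then the chain
`V_b = evenPart ⊓ (A_b ⊔ B_b)ᗮ` satisfies `V_a ⊆ closure ⋃_{b>a} V_b`. (Printed: "`⋂_{b>a}(A_b + B_b) =
(⋂A_b) + (⋂B_b)` … as `K_a = (A_a+B_a)^⊥` … and `A_a + B_a` is closed".)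
[cite: Burnol2004b, Prop. 4.6 and its proof (TeX l.790–804)] -/
private theorem subset_closure_iUnion_of_chain (a : ℝ)
    (A B : ℝ → Submodule ℂ (Lp ℂ 2 (volume : Measure ℝ)))
    (hA : ∀ b, A b ≤ (cutoffProj b).range) (hB : ∀ b, B b ≤ (cutoffProjHat b).range)
    (hcl : ∀ b, IsClosed ((A b ⊔ B b : Submodule ℂ (Lp ℂ 2 (volume : Measure ℝ))) :
      Set (Lp ℂ 2 (volume : Measure ℝ))))
    (hR : ∀ b, ∀ v ∈ (A b ⊔ B b)ᗮ, Lp.compMeasurePreserving (fun x : ℝ ↦ -x)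
      (Measure.measurePreserving_neg (volume : Measure ℝ)) v ∈ (A b ⊔ B b)ᗮ)
    (hAmono : ∀ b₁ b₂, b₁ ≤ b₂ → A b₁ ≤ A b₂) (hBmono : ∀ b₁ b₂, b₁ ≤ b₂ → B b₁ ≤ B b₂)
    (hAint : ∀ x, (∀ b, a < b → b ≤ a + 1 → x ∈ A b) → x ∈ A a)
    (hBint : ∀ x, (∀ b, a < b → b ≤ a + 1 → x ∈ B b) → x ∈ B a) :
    ((evenPart ⊓ (A a ⊔ B a)ᗮ : Submodule ℂ (Lp ℂ 2 (volume : Measure ℝ))) :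
        Set (Lp ℂ 2 (volume : Measure ℝ))) ⊆
      closure (⋃ b ∈ Set.Ioi a, ((evenPart ⊓ (A b ⊔ B b)ᗮ :
        Submodule ℂ (Lp ℂ 2 (volume : Measure ℝ))) : Set (Lp ℂ 2 (volume : Measure ℝ)))) := by
  -- notation-free abbreviations
  set V : ℝ → Submodule ℂ (Lp ℂ 2 (volume : Measure ℝ)) := fun b ↦ evenPart ⊓ (A b ⊔ B b)ᗮ with hV
  have hVanti : ∀ b₁ b₂, b₁ ≤ b₂ → V b₂ ≤ V b₁ := by
    intro b₁ b₂ h x hx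
    obtain ⟨hx1, hx2⟩ := Submodule.mem_inf.1 hx
    refine Submodule.mem_inf.2 ⟨hx1, ?_⟩
    exact Submodule.orthogonal_le (sup_le_sup (hAmono b₁ b₂ h) (hBmono b₁ b₂ h)) hx2
  intro t ht
  -- the directed union as a submodule and its closure
  let S : Submodule ℂ (Lp ℂ 2 (volume : Measure ℝ)) :=
    { carrier := ⋃ b ∈ Set.Ioi a, (V b : Set (Lp ℂ 2 (volume : Measure ℝ)))
      add_mem' := by
        intro x y hx hy
        obtain ⟨b₁, hb₁, hx⟩ := Set.mem_iUnion₂.1 hx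
        obtain ⟨b₂, hb₂, hy⟩ := Set.mem_iUnion₂.1 hy
        refine Set.mem_iUnion₂.2 ⟨min b₁ b₂, Set.mem_Ioi.2 (lt_min (Set.mem_Ioi.1 hb₁)
          (Set.mem_Ioi.1 hb₂)), ?_⟩
        exact (V (min b₁ b₂)).add_mem (hVanti _ _ (min_le_left b₁ b₂) hx)
          (hVanti _ _ (min_le_right b₁ b₂) hy)
      zero_mem' := Set.mem_iUnion₂.2 ⟨a + 1, Set.mem_Ioi.2 (by linarith), (V (a + 1)).zero_mem⟩
      smul_mem' := by
        intro c x hx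
        obtain ⟨b, hb, hx⟩ := Set.mem_iUnion₂.1 hx
        exact Set.mem_iUnion₂.2 ⟨b, hb, (V b).smul_mem c hx⟩ }
  have hScoe : (S : Set (Lp ℂ 2 (volume : Measure ℝ))) =
      ⋃ b ∈ Set.Ioi a, (V b : Set (Lp ℂ 2 (volume : Measure ℝ))) := rfl
  let M : Submodule ℂ (Lp ℂ 2 (volume : Measure ℝ)) := S.topologicalClosure
  have hMcl : (M : Set (Lp ℂ 2 (volume : Measure ℝ))) =
      closure (⋃ b ∈ Set.Ioi a, (V b : Set (Lp ℂ 2 (volume : Measure ℝ)))) := by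
    rw [← hScoe]; exact Submodule.topologicalClosure_coe S
  -- `V a` is closed and contains `M`
  have hVa_closed : IsClosed ((V a : Submodule ℂ (Lp ℂ 2 (volume : Measure ℝ))) :
      Set (Lp ℂ 2 (volume : Measure ℝ))) := by
    rw [hV]; dsimp only
    rw [Submodule.coe_inf]
    exact isClosed_evenPart.inter (Submodule.isClosed_orthogonal _)
  have hSle : S ≤ V a := by
    intro x hx
    obtain ⟨b, hb, hx⟩ := Set.mem_iUnion₂.1 hx
    exact hVanti a b (le_of_lt (Set.mem_Ioi.1 hb)) hx
  have hMle : M ≤ V a := S.topologicalClosure_minimal hSle hVa_closed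
  -- the residual `r = t − proj_M t`
  set r := t - M.starProjection t with hr_def
  have hrM : r ∈ Mᗮ := Submodule.sub_starProjection_mem_orthogonal t
  have hrV : r ∈ V a := (V a).sub_mem ht (hMle (Submodule.starProjection_apply_mem M t))
  have hr_even : r ∈ evenPart := (Submodule.mem_inf.1 hrV).1
  have hr_perp_a : r ∈ (A a ⊔ B a)ᗮ := (Submodule.mem_inf.1 hrV).2
  -- `r ⊥ V b` for `b > a`, hence `r ∈ (A_b ⊔ B_b)ᗮᗮ = A_b ⊔ B_b`
  have hr_mem : ∀ b, a < b → r ∈ A b ⊔ B b := by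
    intro b hb
    have hK : ∀ k ∈ evenPart ⊓ (A b ⊔ B b)ᗮ, ⟪k, r⟫_ℂ = 0 := by
      intro k hk
      have hkS : k ∈ S := Set.mem_iUnion₂.2 ⟨b, Set.mem_Ioi.2 hb, hk⟩
      exact (Submodule.mem_orthogonal M r).1 hrM k (S.le_topologicalClosure hkS)
    have h := mem_orthogonal_orthogonal_of_even (hR b) hr_even hK
    rwa [Submodule.orthogonal_orthogonal_eq_closure, (hcl b).submodule_topologicalClosure_eq] at h
  -- decompositions and their uniqueness
  have hdec : ∀ b, a < b → ∃ α ∈ A b, ∃ β ∈ B b, α + β = r :=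
    fun b hb ↦ Submodule.mem_sup.1 (hr_mem b hb)
  obtain ⟨α₀, hα₀, β₀, hβ₀, hαβ₀⟩ := hdec (a + 1) (by linarith)
  have hconst : ∀ b, a < b → b ≤ a + 1 → α₀ ∈ A b ∧ β₀ ∈ B b := by
    intro b hb hb1
    obtain ⟨α, hα, β, hβ, hαβ⟩ := hdec b hb
    have hαP : α ∈ (cutoffProj (a + 1)).range := range_cutoffProj_mono hb1 (hA b hα)
    have hβP : β ∈ (cutoffProjHat (a + 1)).range := range_cutoffProjHat_mono hb1 (hB b hβ)
    have hα₀P : α₀ ∈ (cutoffProj (a + 1)).range := hA _ hα₀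
    have hβ₀P : β₀ ∈ (cutoffProjHat (a + 1)).range := hB _ hβ₀
    have heq : α = α₀ := eq_of_add_eq_add_of_inf_eq_bot
      (range_cutoffProj_inf_range_cutoffProjHat (a + 1) (a + 1)) hαP hα₀P hβP hβ₀P
      (hαβ.trans hαβ₀.symm)
    have heq' : β = β₀ := by
      have := hαβ.trans hαβ₀.symm
      rw [heq] at this
      exact add_left_cancel this
    exact ⟨heq ▸ hα, heq' ▸ hβ⟩
  have hα₀a : α₀ ∈ A a := hAint α₀ fun b hb hb1 ↦ (hconst b hb hb1).1
  have hβ₀a : β₀ ∈ B a := hBint β₀ fun b hb hb1 ↦ (hconst b hb hb1).2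
  -- `r ∈ A_a ⊔ B_a` and `r ⊥ A_a ⊔ B_a`, so `r = 0`
  have hr_in : r ∈ A a ⊔ B a := hαβ₀ ▸ Submodule.add_mem_sup hα₀a hβ₀a
  have hr0 : r = 0 := by
    have h := Submodule.inner_right_of_mem_orthogonal hr_in hr_perp_a
    exact inner_self_eq_zero.1 h
  have ht_eq : t = M.starProjection t := sub_eq_zero.1 (by rw [← hr_def, hr0])
  rw [← hMcl, ht_eq]
  exact Submodule.starProjection_apply_mem M t

end Engine

/-! ### E. Clause `K`: `⋃_{b>a} K_b` is dense in `K_a` -/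

section ClauseK

/-- `K_b = evenPart ⊓ (ran P_b ⊔ ran P̃_b)ᗮ` (as sets), from `K_b = even ∩ ker P_b ∩ ker P̃_b`
(`Burnol2002.mem_sonineK_iff_cutoffProj`). [cite: Burnol2004b, proof of Prop. 4.6 ("`K_a = (A_a+B_a)^⊥`", TeX l.800–803)] -/
private theorem sonineK_eq_inf_orthogonal (b : ℝ) :
    sonineK b = ((evenPart ⊓ ((cutoffProj b).range ⊔ (cutoffProjHat b).range)ᗮ :
      Submodule ℂ (Lp ℂ 2 (volume : Measure ℝ))) : Set (Lp ℂ 2 (volume : Measure ℝ))) := by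
  ext f
  rw [SetLike.mem_coe, Submodule.mem_inf, mem_sonineK_iff_cutoffProj, ← Submodule.inf_orthogonal,
    Submodule.mem_inf]
  constructor
  · rintro ⟨he, h1, h2⟩
    exact ⟨he, mem_orthogonal_range_of_apply_eq_zero (isStarProjection_cutoffProj b) h1,
      mem_orthogonal_range_of_apply_eq_zero (isStarProjection_cutoffProjHat b) h2⟩
  · rintro ⟨he, h1, h2⟩
    exact ⟨he, apply_eq_zero_of_mem_orthogonal_range (isStarProjection_cutoffProj b) h1,
      apply_eq_zero_of_mem_orthogonal_range (isStarProjection_cutoffProjHat b) h2⟩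

/-- The orthogonal complement of `ran P_b ⊔ ran P̃_b` is stable under the reflection (`P_b`, `P̃_b`
commute with `R`). [folklore] -/
private theorem compNeg_mem_orthogonal_ranges (b : ℝ) (v : Lp ℂ 2 (volume : Measure ℝ))
    (hv : v ∈ ((cutoffProj b).range ⊔ (cutoffProjHat b).range)ᗮ) :
    Lp.compMeasurePreserving (fun x : ℝ ↦ -x) (Measure.measurePreserving_neg (volume : Measure ℝ)) v ∈
      ((cutoffProj b).range ⊔ (cutoffProjHat b).range)ᗮ := by
  rw [← Submodule.inf_orthogonal, Submodule.mem_inf] at hv ⊢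
  obtain ⟨h1, h2⟩ := hv
  have h1' := apply_eq_zero_of_mem_orthogonal_range (isStarProjection_cutoffProj b) h1
  have h2' := apply_eq_zero_of_mem_orthogonal_range (isStarProjection_cutoffProjHat b) h2
  refine ⟨mem_orthogonal_range_of_apply_eq_zero (isStarProjection_cutoffProj b) ?_,
    mem_orthogonal_range_of_apply_eq_zero (isStarProjection_cutoffProjHat b) ?_⟩
  · rw [← compNeg_cutoffProj, h1', map_zero]
  · rw [← compNeg_cutoffProjHat, h2', map_zero]

/-- **Prop. 4.6, first clause: `⋃_{b>a} K_b` is dense in `K_a`** (any real `a`).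
[cite: Burnol2004b, Prop. 4.6 (TeX l.790–804)] -/
theorem sonineK_subset_closure_iUnion (a : ℝ) :
    sonineK a ⊆ closure (⋃ b ∈ Set.Ioi a, sonineK b) := by
  have h := subset_closure_iUnion_of_chain a (fun b ↦ (cutoffProj b).range)
    (fun b ↦ (cutoffProjHat b).range) (fun b ↦ le_rfl) (fun b ↦ le_rfl)
    (fun b ↦ isClosed_range_cutoffProj_sup_range_cutoffProjHat b b)
    (fun b ↦ compNeg_mem_orthogonal_ranges b) (fun b₁ b₂ h ↦ range_cutoffProj_mono h)
    (fun b₁ b₂ h ↦ range_cutoffProjHat_mono h)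
    (fun x hx ↦ mem_range_cutoffProj_of_forall fun n ↦ hx _ (by
        have : (0 : ℝ) < 1 / ((n : ℝ) + 1) := by positivity
        linarith) (by
        have h1 : 1 / ((n : ℝ) + 1) ≤ 1 := by
          rw [div_le_one (by positivity)]; linarith [n.cast_nonneg (α := ℝ)]
        linarith))
    (fun x hx ↦ mem_range_cutoffProjHat_iff.2 (mem_range_cutoffProj_of_forall fun n ↦
      mem_range_cutoffProjHat_iff.1 (hx _ (by
        have : (0 : ℝ) < 1 / ((n : ℝ) + 1) := by positivity
        linarith) (by
        have h1 : 1 / ((n : ℝ) + 1) ≤ 1 := by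
          rw [div_le_one (by positivity)]; linarith [n.cast_nonneg (α := ℝ)]
        linarith))))
  rw [sonineK_eq_inf_orthogonal a]
  refine h.trans (closure_mono ?_)
  exact Set.iUnion₂_mono fun b _ ↦ (sonineK_eq_inf_orthogonal b).symm.subset

end ClauseK

/-! ### F. Clause `L`: `⋃_{b>a} L_b` is dense in `L_a` -/

section ClauseL

/-- For a star projection `P`, a vector `χ ∈ ran P` and `v`: `v ⊥ (ran P ⊓ (ℂχ)ᗮ)` iff `P v ∈ ℂχ`,
quantitatively `P v = (⟨χ,v⟩/⟨χ,χ⟩) χ` (`χ ≠ 0`). Direction `→`. [cite: Burnol2004b, proof of Prop. 4.5 ("`L_a` is the perpendicular complement to …", TeX l.779–785)] -/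
private theorem apply_eq_smul_of_mem_orthogonal {E : Type*} [NormedAddCommGroup E]
    [InnerProductSpace ℂ E] [CompleteSpace E] {P : E →L[ℂ] E} (hP : IsStarProjection P) {χ : E}
    (hχ : χ ∈ P.range) (hχ0 : χ ≠ 0) {v : E} (hv : v ∈ (P.range ⊓ (ℂ ∙ χ)ᗮ)ᗮ) :
    P v = (⟪χ, v⟫_ℂ / ⟪χ, χ⟫_ℂ) • χ := by
  have hPs := hP.isSelfAdjoint.isSymmetric
  have hχχ : ⟪χ, χ⟫_ℂ ≠ 0 := inner_self_ne_zero.2 hχ0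
  have hPχ : P χ = χ := (mem_range_iff_apply_eq hP.isIdempotentElem).1 hχ
  set c : ℂ := ⟪χ, v⟫_ℂ / ⟪χ, χ⟫_ℂ with hc
  set α₀ : E := P v - c • χ with hα₀
  -- `α₀ ∈ ran P ⊓ (ℂχ)ᗮ`
  have hα₀P : α₀ ∈ P.range := P.range.sub_mem (LinearMap.mem_range_self _ v) (P.range.smul_mem c hχ)
  have hα₀χ : ⟪χ, α₀⟫_ℂ = 0 := by
    have e : ⟪χ, P v⟫_ℂ = ⟪χ, v⟫_ℂ := by
      calc ⟪χ, P v⟫_ℂ = ⟪P χ, v⟫_ℂ := (hPs χ v).symm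
        _ = ⟪χ, v⟫_ℂ := by rw [hPχ]
    rw [hα₀, inner_sub_right, inner_smul_right, e, hc, div_mul_cancel₀ _ hχχ, sub_self]
  have hα₀mem : α₀ ∈ P.range ⊓ (ℂ ∙ χ)ᗮ :=
    Submodule.mem_inf.2 ⟨hα₀P, Submodule.mem_orthogonal_singleton_iff_inner_right.2 hα₀χ⟩
  have h0 : ⟪α₀, v⟫_ℂ = 0 := (Submodule.mem_orthogonal _ v).1 hv α₀ hα₀mem
  -- `‖α₀‖² = ⟨α₀, Pv⟩ − c⟨α₀, χ⟩ = ⟨α₀, v⟩ − 0 = 0`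
  have hPα₀ : P α₀ = α₀ := (mem_range_iff_apply_eq hP.isIdempotentElem).1 hα₀P
  have h1 : ⟪α₀, α₀⟫_ℂ = 0 := by
    have e1 : ⟪α₀, P v⟫_ℂ = ⟪α₀, v⟫_ℂ := by
      calc ⟪α₀, P v⟫_ℂ = ⟪P α₀, v⟫_ℂ := (hPs α₀ v).symm
        _ = ⟪α₀, v⟫_ℂ := by rw [hPα₀]
    have e2 : ⟪α₀, χ⟫_ℂ = 0 := by rw [← inner_conj_symm, hα₀χ, map_zero]
    calc ⟪α₀, α₀⟫_ℂ = ⟪α₀, P v - c • χ⟫_ℂ := by rw [hα₀]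
      _ = ⟪α₀, P v⟫_ℂ - c * ⟪α₀, χ⟫_ℂ := by rw [inner_sub_right, inner_smul_right]
      _ = 0 := by rw [e1, h0, e2, mul_zero, sub_zero]
  have h2 : α₀ = 0 := inner_self_eq_zero.1 h1
  rw [hα₀, sub_eq_zero] at h2
  exact h2

/-- Direction `←`: if `P v = c χ` then `v ⊥ (ran P ⊓ (ℂχ)ᗮ)`. [cite: Burnol2004b, proof of Prop. 4.5 (TeX l.779–785)] -/
private theorem mem_orthogonal_of_apply_eq_smul {E : Type*} [NormedAddCommGroup E]
    [InnerProductSpace ℂ E] [CompleteSpace E] {P : E →L[ℂ] E} (hP : IsStarProjection P) {χ v : E}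
    {c : ℂ} (hv : P v = c • χ) : v ∈ (P.range ⊓ (ℂ ∙ χ)ᗮ)ᗮ := by
  have hPs := hP.isSelfAdjoint.isSymmetric
  rw [Submodule.mem_orthogonal]
  intro α hα
  obtain ⟨hαP, hαχ⟩ := Submodule.mem_inf.1 hα
  have hαχ' : ⟪χ, α⟫_ℂ = 0 := Submodule.mem_orthogonal_singleton_iff_inner_right.1 hαχ
  have hPα : P α = α := (mem_range_iff_apply_eq hP.isIdempotentElem).1 hαP
  calc ⟪α, v⟫_ℂ = ⟪P α, v⟫_ℂ := by rw [hPα]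
    _ = ⟪α, P v⟫_ℂ := hPs α v
    _ = c * ⟪α, χ⟫_ℂ := by rw [hv, inner_smul_right]
    _ = 0 := by rw [← inner_conj_symm, hαχ', map_zero, mul_zero]

/-- `𝟙_{[−b,b]} ≠ 0` in `L²(ℝ)` for `b > 0`. [folklore] -/
private theorem indicatorConstLp_ne_zero {b : ℝ} (hb : 0 < b) :
    (indicatorConstLp 2 (measurableSet_Icc : MeasurableSet (Icc (-b) b)) measure_Icc_lt_top.ne (1 : ℂ) :
      Lp ℂ 2 (volume : Measure ℝ)) ≠ 0 := by
  intro h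
  have hn := congrArg (fun u : Lp ℂ 2 (volume : Measure ℝ) ↦ ‖u‖) h
  simp only [norm_indicatorConstLp two_ne_zero ENNReal.ofNat_ne_top, norm_one, one_mul,
    norm_zero] at hn
  rw [Real.volume_real_Icc_of_le (by linarith)] at hn
  have : (0 : ℝ) < (b - -b) ^ (1 / (2 : ℝ≥0∞).toReal) := by
    apply Real.rpow_pos_of_pos; linarith
  linarith

/-- a.e. form of `P_b v = c·𝟙_{[−b,b]}`: `v = c` a.e. on `[−b,b]`. [folklore] -/
private theorem ae_eq_const_of_cutoffProj_eq_smul {b : ℝ} {v : Lp ℂ 2 (volume : Measure ℝ)} {c : ℂ}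
    (hv : cutoffProj b v = c • indicatorConstLp 2 (measurableSet_Icc : MeasurableSet (Icc (-b) b))
      measure_Icc_lt_top.ne (1 : ℂ)) :
    ∀ᵐ t : ℝ, t ∈ Icc (-b) b → (v : ℝ → ℂ) t = c := by
  have h1 := cutoffProj_coeFn b v
  rw [hv] at h1
  filter_upwards [h1, Lp.coeFn_smul c (indicatorConstLp 2
      (measurableSet_Icc : MeasurableSet (Icc (-b) b)) measure_Icc_lt_top.ne (1 : ℂ)),
    indicatorConstLp_coeFn (p := 2) (hs := (measurableSet_Icc : MeasurableSet (Icc (-b) b)))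
      (hμs := measure_Icc_lt_top.ne) (c := (1 : ℂ))] with t ht hs hi htb
  have := ht.symm
  rw [hs, Pi.smul_apply, hi, Set.indicator_of_mem htb, Set.indicator_of_mem htb, smul_eq_mul,
    mul_one] at this
  exact this

/-- Converse a.e. form: if `v = c` a.e. on `[−b,b]` then `P_b v = c·𝟙_{[−b,b]}`. [folklore] -/
private theorem cutoffProj_eq_smul_of_ae_eq_const {b : ℝ} {v : Lp ℂ 2 (volume : Measure ℝ)} {c : ℂ}
    (hv : ∀ᵐ t : ℝ, t ∈ Icc (-b) b → (v : ℝ → ℂ) t = c) :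
    cutoffProj b v = c • indicatorConstLp 2 (measurableSet_Icc : MeasurableSet (Icc (-b) b))
      measure_Icc_lt_top.ne (1 : ℂ) := by
  apply Lp.ext
  filter_upwards [cutoffProj_coeFn b v, hv, Lp.coeFn_smul c (indicatorConstLp 2
      (measurableSet_Icc : MeasurableSet (Icc (-b) b)) measure_Icc_lt_top.ne (1 : ℂ)),
    indicatorConstLp_coeFn (p := 2) (hs := (measurableSet_Icc : MeasurableSet (Icc (-b) b)))
      (hμs := measure_Icc_lt_top.ne) (c := (1 : ℂ))] with t ht hc hs hi
  rw [ht, hs, Pi.smul_apply, hi]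
  by_cases htb : t ∈ Icc (-b) b
  · rw [Set.indicator_of_mem htb, Set.indicator_of_mem htb, hc htb, smul_eq_mul, mul_one]
  · rw [Set.indicator_of_notMem htb, Set.indicator_of_notMem htb, smul_zero]

/-- For an even `L²` class, being a.e. constant on `(0,b)` is being a.e. constant on `[−b,b]`.
[folklore] -/
private theorem ae_eq_const_Icc_of_Ioo {b : ℝ} {v : Lp ℂ 2 (volume : Measure ℝ)} (hve : v ∈ evenPart)
    {c : ℂ} (hv : ∀ᵐ t : ℝ, t ∈ Ioo 0 b → (v : ℝ → ℂ) t = c) :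
    ∀ᵐ t : ℝ, t ∈ Icc (-b) b → (v : ℝ → ℂ) t = c := by
  have hneg : Measure.QuasiMeasurePreserving (fun x : ℝ ↦ -x) volume volume :=
    (Measure.measurePreserving_neg (volume : Measure ℝ)).quasiMeasurePreserving
  have hve' : ∀ᵐ t : ℝ, (v : ℝ → ℂ) (-t) = (v : ℝ → ℂ) t := hve
  have hnull : ∀ᵐ t : ℝ, t ∉ ({-b, 0, b} : Set ℝ) :=
    compl_mem_ae_iff.mpr ((Set.toFinite _).measure_zero volume)
  filter_upwards [hv, hneg.ae hv, hve', hnull] with t h1 h2 h3 h4 htb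
  simp only [mem_insert_iff, mem_singleton_iff, not_or] at h4
  rcases lt_or_gt_of_ne h4.2.1 with hneg' | hpos
  · rw [← h3]
    exact h2 ⟨by linarith, lt_of_le_of_ne (by linarith [htb.1]) fun h ↦ h4.1 (by linarith)⟩
  · exact h1 ⟨hpos, lt_of_le_of_ne htb.2 h4.2.2⟩

/-- The Fourier partner: `v ⊥ (ran P̃_b ⊓ (ℂ𝓕⁻¹χ_b)ᗮ)` iff `𝓕v ⊥ (ran P_b ⊓ (ℂχ_b)ᗮ)`. [folklore] -/
private theorem mem_orthogonal_hat_iff {b : ℝ} {χ v : Lp ℂ 2 (volume : Measure ℝ)} :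
    v ∈ ((cutoffProjHat b).range ⊓ (ℂ ∙ (𝓕⁻ χ : Lp ℂ 2 (volume : Measure ℝ)))ᗮ)ᗮ ↔
      (𝓕 v : Lp ℂ 2 (volume : Measure ℝ)) ∈ ((cutoffProj b).range ⊓ (ℂ ∙ χ)ᗮ)ᗮ := by
  -- the map `α ↦ 𝓕⁻¹α` is a bijection between the two test spaces
  have key : ∀ α : Lp ℂ 2 (volume : Measure ℝ),
      α ∈ (cutoffProj b).range ⊓ (ℂ ∙ χ)ᗮ ↔
        (𝓕⁻ α : Lp ℂ 2 (volume : Measure ℝ)) ∈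
          (cutoffProjHat b).range ⊓ (ℂ ∙ (𝓕⁻ χ : Lp ℂ 2 (volume : Measure ℝ)))ᗮ := by
    intro α
    rw [Submodule.mem_inf, Submodule.mem_inf, mem_range_cutoffProjHat_iff, fourier_fourierInv_eq,
      Submodule.mem_orthogonal_singleton_iff_inner_right,
      Submodule.mem_orthogonal_singleton_iff_inner_right]
    have e : ⟪(𝓕⁻ χ : Lp ℂ 2 (volume : Measure ℝ)), (𝓕⁻ α : Lp ℂ 2 (volume : Measure ℝ))⟫_ℂ =
        ⟪χ, α⟫_ℂ := by
      rw [← Lp.inner_fourier_eq (𝓕⁻ χ : Lp ℂ 2 (volume : Measure ℝ))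
        (𝓕⁻ α : Lp ℂ 2 (volume : Measure ℝ)), fourier_fourierInv_eq, fourier_fourierInv_eq]
    rw [e]
  rw [Submodule.mem_orthogonal, Submodule.mem_orthogonal]
  constructor
  · intro h α hα
    rw [inner_fourier_right]
    exact h _ ((key α).1 hα)
  · intro h β hβ
    have hβ' : (𝓕 β : Lp ℂ 2 (volume : Measure ℝ)) ∈ (cutoffProj b).range ⊓ (ℂ ∙ χ)ᗮ := by
      have := (key (𝓕 β : Lp ℂ 2 (volume : Measure ℝ))).2
      rw [fourierInv_fourier_eq] at this
      exact this hβ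
    have := h _ hβ'
    rwa [Lp.inner_fourier_eq] at this

/-- **`L_b` through the two projections** (`b > 0`): `f ∈ L_b` iff `f` is even, `f ⊥ (ran P_b ⊓ (ℂχ_b)ᗮ)`
and `f ⊥ (ran P̃_b ⊓ (ℂ𝓕⁻¹χ_b)ᗮ)`, `χ_b = 𝟙_{[−b,b]}` ("`L_a` is the perpendicular complement to
`(L²(0,a) ∩ 𝟙^⊥) + 𝓕₊(L²(0,a) ∩ 𝟙^⊥)`"). [cite: Burnol2004b, proof of Prop. 4.5 (TeX l.779–785)] -/
private theorem sonineL_eq_inf_orthogonal {b : ℝ} (hb : 0 < b) :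
    sonineL b = ((evenPart ⊓ (((cutoffProj b).range ⊓ (ℂ ∙ indicatorConstLp 2
        (measurableSet_Icc : MeasurableSet (Icc (-b) b)) measure_Icc_lt_top.ne (1 : ℂ))ᗮ) ⊔
      ((cutoffProjHat b).range ⊓ (ℂ ∙ (𝓕⁻ (indicatorConstLp 2
        (measurableSet_Icc : MeasurableSet (Icc (-b) b)) measure_Icc_lt_top.ne (1 : ℂ) :
          Lp ℂ 2 (volume : Measure ℝ)) : Lp ℂ 2 (volume : Measure ℝ)))ᗮ))ᗮ : Submodule ℂ (Lp ℂ 2 (volume : Measure ℝ))) :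
        Set (Lp ℂ 2 (volume : Measure ℝ))) := by
  set χ : Lp ℂ 2 (volume : Measure ℝ) := indicatorConstLp 2
    (measurableSet_Icc : MeasurableSet (Icc (-b) b)) measure_Icc_lt_top.ne (1 : ℂ) with hχ
  have hχP : χ ∈ (cutoffProj b).range := indicatorConstLp_mem_range_cutoffProj b
  have hχ0 : χ ≠ 0 := indicatorConstLp_ne_zero hb
  ext f
  rw [SetLike.mem_coe, Submodule.mem_inf, ← Submodule.inf_orthogonal, Submodule.mem_inf]
  constructor
  · rintro ⟨he, ⟨c, hc⟩, ⟨c', hc'⟩⟩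
    have he' : f ∈ evenPart := he
    have hFe : (𝓕 f : Lp ℂ 2 (volume : Measure ℝ)) ∈ evenPart := fourier_mem_evenL2 he
    refine ⟨he', mem_orthogonal_of_apply_eq_smul (isStarProjection_cutoffProj b)
      (cutoffProj_eq_smul_of_ae_eq_const (ae_eq_const_Icc_of_Ioo he' hc)), ?_⟩
    rw [mem_orthogonal_hat_iff]
    exact mem_orthogonal_of_apply_eq_smul (isStarProjection_cutoffProj b)
      (cutoffProj_eq_smul_of_ae_eq_const (ae_eq_const_Icc_of_Ioo hFe hc'))
  · rintro ⟨he, h1, h2⟩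
    have he' : f ∈ evenL2 := he
    refine ⟨he', ⟨⟪χ, f⟫_ℂ / ⟪χ, χ⟫_ℂ, ?_⟩, ⟨⟪χ, (𝓕 f : Lp ℂ 2 (volume : Measure ℝ))⟫_ℂ / ⟪χ, χ⟫_ℂ, ?_⟩⟩
    · have h := ae_eq_const_of_cutoffProj_eq_smul
        (apply_eq_smul_of_mem_orthogonal (isStarProjection_cutoffProj b) hχP hχ0 h1)
      filter_upwards [h] with t ht htb
      exact ht ⟨by linarith [htb.1, htb.2], htb.2.le⟩
    · rw [mem_orthogonal_hat_iff] at h2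
      have h := ae_eq_const_of_cutoffProj_eq_smul
        (apply_eq_smul_of_mem_orthogonal (isStarProjection_cutoffProj b) hχP hχ0 h2)
      filter_upwards [h] with t ht htb
      exact ht ⟨by linarith [htb.1, htb.2], htb.2.le⟩

/-- `𝟙_{[−b,b]}` is fixed by the reflection. [folklore] -/
private theorem compNeg_indicatorConstLp (b : ℝ) :
    Lp.compMeasurePreserving (fun x : ℝ ↦ -x) (Measure.measurePreserving_neg (volume : Measure ℝ))
      (indicatorConstLp 2 (measurableSet_Icc : MeasurableSet (Icc (-b) b)) measure_Icc_lt_top.ne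
        (1 : ℂ)) =
      indicatorConstLp 2 (measurableSet_Icc : MeasurableSet (Icc (-b) b)) measure_Icc_lt_top.ne
        (1 : ℂ) := by
  have hneg : Measure.QuasiMeasurePreserving (fun x : ℝ ↦ -x) volume volume :=
    (Measure.measurePreserving_neg (volume : Measure ℝ)).quasiMeasurePreserving
  have hi := indicatorConstLp_coeFn (p := 2) (hs := (measurableSet_Icc : MeasurableSet (Icc (-b) b)))
    (hμs := measure_Icc_lt_top.ne) (c := (1 : ℂ)) (μ := (volume : Measure ℝ))
  apply Lp.ext
  filter_upwards [coeFn_compNeg (F := ℂ) (indicatorConstLp 2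
      (measurableSet_Icc : MeasurableSet (Icc (-b) b)) measure_Icc_lt_top.ne (1 : ℂ)),
    hi, hneg.ae hi] with t h1 h2 h3
  rw [h1, h3, h2]
  by_cases htb : t ∈ Icc (-b) b
  · rw [Set.indicator_of_mem htb, Set.indicator_of_mem (show -t ∈ Icc (-b) b from
      ⟨by linarith [htb.2], by linarith [htb.1]⟩)]
  · rw [Set.indicator_of_notMem htb, Set.indicator_of_notMem (fun h ↦ htb
      ⟨by linarith [h.2], by linarith [h.1]⟩)]

/-- The orthogonal complement of `A'_b ⊔ B'_b` is stable under the reflection. [folklore] -/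
private theorem compNeg_mem_orthogonal_primed {b : ℝ} (hb : 0 < b) (v : Lp ℂ 2 (volume : Measure ℝ))
    (hv : v ∈ (((cutoffProj b).range ⊓ (ℂ ∙ indicatorConstLp 2
        (measurableSet_Icc : MeasurableSet (Icc (-b) b)) measure_Icc_lt_top.ne (1 : ℂ))ᗮ) ⊔
      ((cutoffProjHat b).range ⊓ (ℂ ∙ (𝓕⁻ (indicatorConstLp 2
        (measurableSet_Icc : MeasurableSet (Icc (-b) b)) measure_Icc_lt_top.ne (1 : ℂ) :
          Lp ℂ 2 (volume : Measure ℝ)) : Lp ℂ 2 (volume : Measure ℝ)))ᗮ))ᗮ) :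
    Lp.compMeasurePreserving (fun x : ℝ ↦ -x) (Measure.measurePreserving_neg (volume : Measure ℝ)) v ∈
      (((cutoffProj b).range ⊓ (ℂ ∙ indicatorConstLp 2
        (measurableSet_Icc : MeasurableSet (Icc (-b) b)) measure_Icc_lt_top.ne (1 : ℂ))ᗮ) ⊔
      ((cutoffProjHat b).range ⊓ (ℂ ∙ (𝓕⁻ (indicatorConstLp 2
        (measurableSet_Icc : MeasurableSet (Icc (-b) b)) measure_Icc_lt_top.ne (1 : ℂ) :
          Lp ℂ 2 (volume : Measure ℝ)) : Lp ℂ 2 (volume : Measure ℝ)))ᗮ))ᗮ := by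
  set χ : Lp ℂ 2 (volume : Measure ℝ) := indicatorConstLp 2
    (measurableSet_Icc : MeasurableSet (Icc (-b) b)) measure_Icc_lt_top.ne (1 : ℂ) with hχ
  have hχP : χ ∈ (cutoffProj b).range := indicatorConstLp_mem_range_cutoffProj b
  have hχ0 : χ ≠ 0 := indicatorConstLp_ne_zero hb
  have hRχ : Lp.compMeasurePreserving (fun x : ℝ ↦ -x)
      (Measure.measurePreserving_neg (volume : Measure ℝ)) χ = χ := compNeg_indicatorConstLp b
  have hRsmul : ∀ (c : ℂ) (u : Lp ℂ 2 (volume : Measure ℝ)),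
      Lp.compMeasurePreserving (fun x : ℝ ↦ -x) (Measure.measurePreserving_neg (volume : Measure ℝ))
          (c • u) =
        c • Lp.compMeasurePreserving (fun x : ℝ ↦ -x)
          (Measure.measurePreserving_neg (volume : Measure ℝ)) u :=
    fun c u ↦ (Lp.compMeasurePreservingₗ ℂ (fun x : ℝ ↦ -x)
      (Measure.measurePreserving_neg (volume : Measure ℝ))).map_smul c u
  rw [← Submodule.inf_orthogonal, Submodule.mem_inf] at hv ⊢
  obtain ⟨h1, h2⟩ := hv
  have e1 := apply_eq_smul_of_mem_orthogonal (isStarProjection_cutoffProj b) hχP hχ0 h1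
  rw [mem_orthogonal_hat_iff] at h2
  have e2 := apply_eq_smul_of_mem_orthogonal (isStarProjection_cutoffProj b) hχP hχ0 h2
  refine ⟨mem_orthogonal_of_apply_eq_smul (isStarProjection_cutoffProj b)
    (c := ⟪χ, v⟫_ℂ / ⟪χ, χ⟫_ℂ) ?_, ?_⟩
  · rw [← compNeg_cutoffProj, e1, hRsmul, hRχ]
  · rw [mem_orthogonal_hat_iff, fourier_compNeg]
    exact mem_orthogonal_of_apply_eq_smul (isStarProjection_cutoffProj b)
      (c := ⟪χ, (𝓕 v : Lp ℂ 2 (volume : Measure ℝ))⟫_ℂ / ⟪χ, χ⟫_ℂ)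
      (by rw [← compNeg_cutoffProj, e2, hRsmul, hRχ])

/-- **Prop. 4.6, second clause: `⋃_{b>a} L_b` is dense in `L_a`** (`a > 0`).
[cite: Burnol2004b, Prop. 4.6 (TeX l.790–804) with the second proof of Prop. 4.5 (TeX l.779–785)] -/
theorem sonineL_subset_closure_iUnion {a : ℝ} (ha : 0 < a) :
    sonineL a ⊆ closure (⋃ b ∈ Set.Ioi a, sonineL b) := by
  -- the primed chains
  set A : ℝ → Submodule ℂ (Lp ℂ 2 (volume : Measure ℝ)) := fun b ↦
    (cutoffProj b).range ⊓ (ℂ ∙ indicatorConstLp 2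
      (measurableSet_Icc : MeasurableSet (Icc (-b) b)) measure_Icc_lt_top.ne (1 : ℂ))ᗮ with hAdef
  set B : ℝ → Submodule ℂ (Lp ℂ 2 (volume : Measure ℝ)) := fun b ↦
    (cutoffProjHat b).range ⊓ (ℂ ∙ (𝓕⁻ (indicatorConstLp 2
      (measurableSet_Icc : MeasurableSet (Icc (-b) b)) measure_Icc_lt_top.ne (1 : ℂ) :
        Lp ℂ 2 (volume : Measure ℝ)) : Lp ℂ 2 (volume : Measure ℝ)))ᗮ with hBdef
  have hA : ∀ b, A b ≤ (cutoffProj b).range := fun b ↦ inf_le_left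
  have hB : ∀ b, B b ≤ (cutoffProjHat b).range := fun b ↦ inf_le_left
  have hBiff : ∀ b (x : Lp ℂ 2 (volume : Measure ℝ)), x ∈ B b ↔
      (𝓕 x : Lp ℂ 2 (volume : Measure ℝ)) ∈ A b := by
    intro b x
    rw [hAdef, hBdef]; dsimp only
    rw [Submodule.mem_inf, Submodule.mem_inf, mem_range_cutoffProjHat_iff,
      Submodule.mem_orthogonal_singleton_iff_inner_right,
      Submodule.mem_orthogonal_singleton_iff_inner_right, ← inner_fourier_right]
  have hcl : ∀ b, IsClosed ((A b ⊔ B b : Submodule ℂ (Lp ℂ 2 (volume : Measure ℝ))) :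
      Set (Lp ℂ 2 (volume : Measure ℝ))) := by
    intro b
    refine isClosed_sup_of_le_range (isStarProjection_cutoffProj b) (isStarProjection_cutoffProjHat b)
      (norm_cutoffProj_comp_cutoffProjHat_lt_one b b) (hA b) (hB b) ?_ ?_
    · rw [hAdef]; dsimp only
      rw [Submodule.coe_inf]
      exact (ContinuousLinearMap.IsIdempotentElem.isClosed_range
        (isStarProjection_cutoffProj b).isIdempotentElem).inter (Submodule.isClosed_orthogonal _)
    · rw [hBdef]; dsimp only
      rw [Submodule.coe_inf]
      exact (ContinuousLinearMap.IsIdempotentElem.isClosed_range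
        (isStarProjection_cutoffProjHat b).isIdempotentElem).inter (Submodule.isClosed_orthogonal _)
  have hAmono : ∀ b₁ b₂, b₁ ≤ b₂ → A b₁ ≤ A b₂ := by
    intro b₁ b₂ h x hx
    rw [hAdef] at hx ⊢; dsimp only at hx ⊢
    obtain ⟨hx1, hx2⟩ := Submodule.mem_inf.1 hx
    rw [Submodule.mem_orthogonal_singleton_iff_inner_right] at hx2
    refine Submodule.mem_inf.2 ⟨range_cutoffProj_mono h hx1,
      Submodule.mem_orthogonal_singleton_iff_inner_right.2 ?_⟩
    rw [inner_indicatorConstLp_eq_integral h hx1, ← inner_indicatorConstLp_eq_integral le_rfl hx1]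
    exact hx2
  have hBmono : ∀ b₁ b₂, b₁ ≤ b₂ → B b₁ ≤ B b₂ := by
    intro b₁ b₂ h x hx
    rw [hBiff] at hx ⊢
    exact hAmono b₁ b₂ h hx
  have hAint : ∀ x, (∀ b, a < b → b ≤ a + 1 → x ∈ A b) → x ∈ A a := by
    intro x hx
    have hx1 : ∀ b, a < b → b ≤ a + 1 → x ∈ (cutoffProj b).range := fun b hb hb1 ↦
      (Submodule.mem_inf.1 (by simpa only [hAdef] using hx b hb hb1)).1
    have hxa : x ∈ (cutoffProj a).range := mem_range_cutoffProj_of_forall fun n ↦ hx1 _ (by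
        have : (0 : ℝ) < 1 / ((n : ℝ) + 1) := by positivity
        linarith) (by
        have h1 : 1 / ((n : ℝ) + 1) ≤ 1 := by
          rw [div_le_one (by positivity)]; linarith [n.cast_nonneg (α := ℝ)]
        linarith)
    have hx2 := (Submodule.mem_inf.1 (by simpa only [hAdef] using hx (a + 1) (by linarith) le_rfl)).2
    rw [Submodule.mem_orthogonal_singleton_iff_inner_right] at hx2
    rw [hAdef]; dsimp only
    refine Submodule.mem_inf.2 ⟨hxa, Submodule.mem_orthogonal_singleton_iff_inner_right.2 ?_⟩
    rw [inner_indicatorConstLp_eq_integral le_rfl hxa,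
      ← inner_indicatorConstLp_eq_integral (by linarith : a ≤ a + 1) hxa]
    exact hx2
  have hBint : ∀ x, (∀ b, a < b → b ≤ a + 1 → x ∈ B b) → x ∈ B a := by
    intro x hx
    rw [hBiff]
    exact hAint _ fun b hb hb1 ↦ (hBiff b x).1 (hx b hb hb1)
  have h := subset_closure_iUnion_of_chain a A B hA hB hcl
    (fun b v hv ↦ ?_) hAmono hBmono hAint hBint
  · rw [sonineL_eq_inf_orthogonal ha]
    refine h.trans (closure_mono ?_)
    refine Set.iUnion₂_mono fun b hb ↦ ?_
    rw [sonineL_eq_inf_orthogonal (ha.trans (Set.mem_Ioi.1 hb))]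
  · by_cases hb : 0 < b
    · exact compNeg_mem_orthogonal_primed hb v hv
    · -- for `b ≤ 0` both test spaces are trivial-range free: `ran P_b ⊆` classes supported on a null
      -- or one-point set; the reflection argument goes through the characterisation by `P_b v`.
      rw [← Submodule.inf_orthogonal, Submodule.mem_inf] at hv ⊢
      obtain ⟨h1, h2⟩ := hv
      -- `A b = ⊥`-like: every `α ∈ ran P_b` is `0` since `[−b,b]` is null or a point
      have hnull : ∀ α : Lp ℂ 2 (volume : Measure ℝ), α ∈ (cutoffProj b).range → α = 0 := by
        intro α hα
        rw [mem_range_cutoffProj_iff] at hα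
        apply Lp.ext
        have hpt : ∀ᵐ t : ℝ, t ∉ ({0} : Set ℝ) := compl_mem_ae_iff.mpr (measure_singleton 0)
        filter_upwards [hα, Lp.coeFn_zero ℂ 2 (volume : Measure ℝ), hpt] with t ht hz h0
        rw [hz, Pi.zero_apply]
        refine ht fun hm ↦ h0 ?_
        rw [mem_singleton_iff]
        have : b ≤ 0 := not_lt.1 hb
        linarith [hm.1, hm.2]
      have hA0 : ∀ α ∈ A b, α = 0 := fun α hα ↦ hnull α (hA b hα)
      have hB0 : ∀ β ∈ B b, β = 0 := by
        intro β hβ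
        rw [hBiff] at hβ
        have := hA0 _ hβ
        have h' := congrArg (fun u : Lp ℂ 2 (volume : Measure ℝ) ↦
          (𝓕⁻ u : Lp ℂ 2 (volume : Measure ℝ))) this
        simpa only [fourierInv_fourier_eq, fourierInv_zero] using h'
      constructor
      · rw [Submodule.mem_orthogonal]
        intro α hα
        rw [hA0 α hα, inner_zero_left]
      · rw [Submodule.mem_orthogonal]
        intro β hβ
        rw [hB0 β hβ, inner_zero_left]

end ClauseL


/-! ### H. Prop. 4.5: `dim (L_a / K_a) = 2` (the second printed proof) -/

section CodimTwo

variable {E : Type*} [NormedAddCommGroup E] [InnerProductSpace ℂ E] [CompleteSpace E]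

omit [CompleteSpace E] in
/-- A vector orthogonal to `A ⊓ (ℂχ)ᗮ` and to `χ ∈ A`, `χ ≠ 0`, is orthogonal to `A`
(`A = (A ⊓ (ℂχ)ᗮ) ⊕ ℂχ`). [cite: Burnol2004b, proof of Prop. 4.5 ("we then intersect with `L²(0,a)`
to get `K_a`, and this imposes two additional conditions", TeX l.781–785)] -/
private theorem mem_orthogonal_of_prime_of_inner {A : Submodule ℂ E} {χ g : E} (hχA : χ ∈ A)
    (hχ0 : χ ≠ 0) (hg : ∀ α ∈ A ⊓ (ℂ ∙ χ)ᗮ, ⟪α, g⟫_ℂ = 0) (hχg : ⟪χ, g⟫_ℂ = 0) : g ∈ Aᗮ := by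
  rw [Submodule.mem_orthogonal]
  intro α hα
  have hχχ : ⟪χ, χ⟫_ℂ ≠ 0 := inner_self_ne_zero.2 hχ0
  set t : ℂ := ⟪χ, α⟫_ℂ / ⟪χ, χ⟫_ℂ with ht
  have hα' : α - t • χ ∈ A ⊓ (ℂ ∙ χ)ᗮ := by
    refine Submodule.mem_inf.2 ⟨A.sub_mem hα (A.smul_mem t hχA),
      Submodule.mem_orthogonal_singleton_iff_inner_right.2 ?_⟩
    rw [inner_sub_right, inner_smul_right, ht, div_mul_cancel₀ _ hχχ, sub_self]
  calc ⟪α, g⟫_ℂ = ⟪α - t • χ + t • χ, g⟫_ℂ := by rw [sub_add_cancel]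
    _ = ⟪α - t • χ, g⟫_ℂ + (starRingEnd ℂ) t * ⟪χ, g⟫_ℂ := by rw [inner_add_left, inner_smul_left]
    _ = 0 := by rw [hg _ hα', hχg, mul_zero, add_zero]

omit [CompleteSpace E] in
/-- If an additive map `R` preserves `W'` and `W'ᗮ` and fixes `χ`, then it fixes the component `u` of
`χ` orthogonal to `W'` (`χ − u ∈ W'`, `u ∈ W'ᗮ`). [folklore] -/
private theorem map_eq_self_of_sub_mem {R : E →+ E} {W' : Submodule ℂ E}
    (hRW' : ∀ x ∈ W', R x ∈ W') (hRperp : ∀ x ∈ W'ᗮ, R x ∈ W'ᗮ) {χ u : E} (hχ : R χ = χ)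
    (hu : u ∈ W'ᗮ) (hχu : χ - u ∈ W') : R u = u := by
  have h1 : R u - u ∈ W'ᗮ := W'ᗮ.sub_mem (hRperp u hu) hu
  have h2 : R u - u ∈ W' := by
    have : R u - u = (χ - u) - R (χ - u) := by rw [map_sub, hχ]; abel
    rw [this]
    exact W'.sub_mem hχu (hRW' _ hχu)
  have h3 : R u - u ∈ W' ⊓ W'ᗮ := Submodule.mem_inf.2 ⟨h2, h1⟩
  rw [Submodule.inf_orthogonal_eq_bot, Submodule.mem_bot] at h3
  exact sub_eq_zero.1 h3

/-- A symmetric additive map preserving `Wᗮ` preserves the closed subspace `W = Wᗮᗮ`. [folklore] -/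
private theorem map_mem_of_isClosed_of_orthogonal {R : E →+ E}
    (hRsym : ∀ x y : E, ⟪R x, y⟫_ℂ = ⟪x, R y⟫_ℂ) {W : Submodule ℂ E} (hW : IsClosed (W : Set E))
    (hRperp : ∀ x ∈ Wᗮ, R x ∈ Wᗮ) {x : E} (hx : x ∈ W) : R x ∈ W := by
  have h : R x ∈ Wᗮᗮ := by
    rw [Submodule.mem_orthogonal]
    intro y hy
    rw [← hRsym y x]
    exact Submodule.inner_right_of_mem_orthogonal (hRperp y hy)
      (Submodule.le_orthogonal_orthogonal W hx)
  rwa [Submodule.orthogonal_orthogonal_eq_closure, hW.submodule_topologicalClosure_eq] at h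

/-- **The codimension-two argument (second proof of Prop. 4.5).** Let `χ ∈ A`, `ψ ∈ B` be non-zero,
`A ⊓ B = ⊥`, and `W' = (A ⊓ (ℂχ)ᗮ) ⊔ (B ⊓ (ℂψ)ᗮ)` closed. With `u`, `v` the components of `χ`, `ψ`
orthogonal to `W'`: `u, v ∈ W'ᗮ`, `χ − u, ψ − v ∈ W'`, no non-trivial combination `cu + dv` is
orthogonal to `W = A ⊔ B`, and every `f ∈ W'ᗮ` is, modulo `ℂu + ℂv`, orthogonal to `W` ("`L_a` is the
perpendicular complement to `(L²(0,a) ∩ 𝟙^⊥) + 𝓕₊(L²(0,a) ∩ 𝟙^⊥)` … this imposes two additional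
conditions"). [cite: Burnol2004b, proof of Prop. 4.5 ("Another proof", TeX l.779–786)] -/
private theorem exists_pair_of_codim_two {A B : Submodule ℂ E} {χ ψ : E} (hχA : χ ∈ A) (hψB : ψ ∈ B)
    (hχ0 : χ ≠ 0) (hψ0 : ψ ≠ 0) (hAB : A ⊓ B = ⊥)
    (hcl : IsClosed ((A ⊓ (ℂ ∙ χ)ᗮ ⊔ B ⊓ (ℂ ∙ ψ)ᗮ : Submodule ℂ E) : Set E)) :
    ∃ u v : E, u ∈ (A ⊓ (ℂ ∙ χ)ᗮ ⊔ B ⊓ (ℂ ∙ ψ)ᗮ)ᗮ ∧ v ∈ (A ⊓ (ℂ ∙ χ)ᗮ ⊔ B ⊓ (ℂ ∙ ψ)ᗮ)ᗮ ∧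
      χ - u ∈ A ⊓ (ℂ ∙ χ)ᗮ ⊔ B ⊓ (ℂ ∙ ψ)ᗮ ∧ ψ - v ∈ A ⊓ (ℂ ∙ χ)ᗮ ⊔ B ⊓ (ℂ ∙ ψ)ᗮ ∧
      (∀ c d : ℂ, c • u + d • v ∈ (A ⊔ B)ᗮ → c = 0 ∧ d = 0) ∧
      ∀ f ∈ (A ⊓ (ℂ ∙ χ)ᗮ ⊔ B ⊓ (ℂ ∙ ψ)ᗮ)ᗮ, ∃ c d : ℂ, f - c • u - d • v ∈ (A ⊔ B)ᗮ := by
  set W' : Submodule ℂ E := A ⊓ (ℂ ∙ χ)ᗮ ⊔ B ⊓ (ℂ ∙ ψ)ᗮ with hW'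
  have hW'le : W' ≤ A ⊔ B := sup_le_sup inf_le_left inf_le_left
  set M : Submodule ℂ E := W'.topologicalClosure with hM
  have hMW : M = W' := hcl.submodule_topologicalClosure_eq
  have hMle : M ≤ W' := hMW.le
  have hleM : W' ≤ M := hMW.ge
  set u : E := χ - M.starProjection χ with hu_def
  set v : E := ψ - M.starProjection ψ with hv_def
  have hu : u ∈ W'ᗮ := Submodule.orthogonal_le hleM (Submodule.sub_starProjection_mem_orthogonal χ)
  have hv : v ∈ W'ᗮ := Submodule.orthogonal_le hleM (Submodule.sub_starProjection_mem_orthogonal ψ)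
  have hpχ : M.starProjection χ ∈ W' := hMle (Submodule.starProjection_apply_mem M χ)
  have hpψ : M.starProjection ψ ∈ W' := hMle (Submodule.starProjection_apply_mem M ψ)
  have hχu : χ - u ∈ W' := by rw [hu_def, sub_sub_cancel]; exact hpχ
  have hψv : ψ - v ∈ W' := by rw [hv_def, sub_sub_cancel]; exact hpψ
  have huW : u ∈ A ⊔ B := by
    rw [hu_def]; exact (A ⊔ B).sub_mem (Submodule.mem_sup_left hχA) (hW'le hpχ)
  have hvW : v ∈ A ⊔ B := by
    rw [hv_def]; exact (A ⊔ B).sub_mem (Submodule.mem_sup_right hψB) (hW'le hpψ)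
  have hχχ : ⟪χ, χ⟫_ℂ ≠ 0 := inner_self_ne_zero.2 hχ0
  have hψψ : ⟪ψ, ψ⟫_ℂ ≠ 0 := inner_self_ne_zero.2 hψ0
  refine ⟨u, v, hu, hv, hχu, hψv, ?_, ?_⟩
  · -- independence modulo `Wᗮ`
    intro c d hcd
    have hx0 : c • u + d • v = 0 := by
      have hxW : c • u + d • v ∈ A ⊔ B :=
        (A ⊔ B).add_mem ((A ⊔ B).smul_mem c huW) ((A ⊔ B).smul_mem d hvW)
      exact inner_self_eq_zero.1 (Submodule.inner_right_of_mem_orthogonal hxW hcd)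
    have hmem : c • χ + d • ψ ∈ W' := by
      have : c • χ + d • ψ = c • (χ - u) + d • (ψ - v) + (c • u + d • v) := by
        simp only [smul_sub]; abel
      rw [this, hx0, add_zero]
      exact W'.add_mem (W'.smul_mem c hχu) (W'.smul_mem d hψv)
    obtain ⟨α', hα', β', hβ', hsum⟩ := Submodule.mem_sup.1 hmem
    have hα'A : α' ∈ A := (Submodule.mem_inf.1 hα').1
    have hβ'B : β' ∈ B := (Submodule.mem_inf.1 hβ').1
    have h1 : α' = c • χ :=
      eq_of_add_eq_add_of_inf_eq_bot hAB hα'A (A.smul_mem c hχA) hβ'B (B.smul_mem d hψB) hsum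
    have h2 : β' = d • ψ := by
      rw [h1] at hsum
      exact add_left_cancel hsum
    have hc : c * ⟪χ, χ⟫_ℂ = 0 := by
      have := Submodule.mem_orthogonal_singleton_iff_inner_right.1 (Submodule.mem_inf.1 hα').2
      rwa [h1, inner_smul_right] at this
    have hd : d * ⟪ψ, ψ⟫_ℂ = 0 := by
      have := Submodule.mem_orthogonal_singleton_iff_inner_right.1 (Submodule.mem_inf.1 hβ').2
      rwa [h2, inner_smul_right] at this
    exact ⟨(mul_eq_zero.1 hc).resolve_right hχχ, (mul_eq_zero.1 hd).resolve_right hψψ⟩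
  · -- every `f ⊥ W'` is, modulo `ℂu + ℂv`, orthogonal to `W`
    intro f hf
    haveI : CompleteSpace ((ℂ ∙ u) ⊔ (ℂ ∙ v) : Submodule ℂ E) := FiniteDimensional.complete ℂ _
    have hwS : ((ℂ ∙ u) ⊔ (ℂ ∙ v)).starProjection f ∈ (ℂ ∙ u) ⊔ (ℂ ∙ v) :=
      Submodule.starProjection_apply_mem _ f
    have hfw : f - ((ℂ ∙ u) ⊔ (ℂ ∙ v)).starProjection f ∈ ((ℂ ∙ u) ⊔ (ℂ ∙ v))ᗮ :=
      Submodule.sub_starProjection_mem_orthogonal f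
    obtain ⟨y, hy, z, hz, hyz⟩ := Submodule.mem_sup.1 hwS
    obtain ⟨c, rfl⟩ := Submodule.mem_span_singleton.1 hy
    obtain ⟨d, rfl⟩ := Submodule.mem_span_singleton.1 hz
    refine ⟨c, d, ?_⟩
    rw [← hyz] at hfw
    have hg : f - c • u - d • v = f - (c • u + d • v) := by abel
    rw [hg]
    have hgW' : f - (c • u + d • v) ∈ W'ᗮ :=
      W'ᗮ.sub_mem hf (W'ᗮ.add_mem (W'ᗮ.smul_mem c hu) (W'ᗮ.smul_mem d hv))
    have hgu : ⟪u, f - (c • u + d • v)⟫_ℂ = 0 := Submodule.inner_right_of_mem_orthogonal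
      (Submodule.mem_sup_left (Submodule.mem_span_singleton_self u)) hfw
    have hgv : ⟪v, f - (c • u + d • v)⟫_ℂ = 0 := Submodule.inner_right_of_mem_orthogonal
      (Submodule.mem_sup_right (Submodule.mem_span_singleton_self v)) hfw
    have hgχ : ⟪χ, f - (c • u + d • v)⟫_ℂ = 0 := by
      calc ⟪χ, f - (c • u + d • v)⟫_ℂ = ⟪χ - u + u, f - (c • u + d • v)⟫_ℂ := by rw [sub_add_cancel]
        _ = 0 := by
          rw [inner_add_left, Submodule.inner_right_of_mem_orthogonal hχu hgW', hgu, add_zero]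
    have hgψ : ⟪ψ, f - (c • u + d • v)⟫_ℂ = 0 := by
      calc ⟪ψ, f - (c • u + d • v)⟫_ℂ = ⟪ψ - v + v, f - (c • u + d • v)⟫_ℂ := by rw [sub_add_cancel]
        _ = 0 := by
          rw [inner_add_left, Submodule.inner_right_of_mem_orthogonal hψv hgW', hgv, add_zero]
    rw [← Submodule.inf_orthogonal]
    refine Submodule.mem_inf.2
      ⟨mem_orthogonal_of_prime_of_inner hχA hχ0 (fun α hα ↦ ?_) hgχ,
        mem_orthogonal_of_prime_of_inner hψB hψ0 (fun β hβ ↦ ?_) hgψ⟩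
    · exact Submodule.inner_right_of_mem_orthogonal (Submodule.mem_sup_left hα : α ∈ W') hgW'
    · exact Submodule.inner_right_of_mem_orthogonal (Submodule.mem_sup_right hβ : β ∈ W') hgW'

end CodimTwo

section ClauseDim

/-- The reflection is symmetric: `⟨Rx, y⟩ = ⟨x, Ry⟩`. [folklore] -/
private theorem inner_compNeg_left_eq (x y : Lp ℂ 2 (volume : Measure ℝ)) :
    ⟪Lp.compMeasurePreserving (fun s : ℝ ↦ -s) (Measure.measurePreserving_neg (volume : Measure ℝ)) x,
      y⟫_ℂ =
      ⟪x, Lp.compMeasurePreserving (fun s : ℝ ↦ -s)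
        (Measure.measurePreserving_neg (volume : Measure ℝ)) y⟫_ℂ := by
  rw [L2.inner_def, L2.inner_def]
  have hx := coeFn_compNeg (F := ℂ) x
  have hy := coeFn_compNeg (F := ℂ) y
  calc ∫ s, ⟪(Lp.compMeasurePreserving (fun s : ℝ ↦ -s)
          (Measure.measurePreserving_neg (volume : Measure ℝ)) x : ℝ → ℂ) s, (y : ℝ → ℂ) s⟫_ℂ
      = ∫ s, ⟪(x : ℝ → ℂ) (-s), (y : ℝ → ℂ) (-(-s))⟫_ℂ := by
        refine integral_congr_ae ?_
        filter_upwards [hx] with s hs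
        rw [hs, neg_neg]
    _ = ∫ s, ⟪(x : ℝ → ℂ) s, (y : ℝ → ℂ) (-s)⟫_ℂ :=
        (Measure.measurePreserving_neg (volume : Measure ℝ)).integral_comp
          (Homeomorph.neg ℝ).measurableEmbedding (fun s ↦ ⟪(x : ℝ → ℂ) s, (y : ℝ → ℂ) (-s)⟫_ℂ)
    _ = ∫ s, ⟪(x : ℝ → ℂ) s, (Lp.compMeasurePreserving (fun s : ℝ ↦ -s)
          (Measure.measurePreserving_neg (volume : Measure ℝ)) y : ℝ → ℂ) s⟫_ℂ := by
        refine integral_congr_ae ?_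
        filter_upwards [hy] with s hs
        rw [hs]

/-- **Prop. 4.5: `dim (L_a/K_a) = 2`** (`a > 0`), as typed: two vectors of `L_a`, independent modulo
`K_a`, which together with `K_a` span `L_a`. The vectors are the components of `χ_a = 𝟙_{[−a,a]}` and of
`𝓕⁻¹χ_a` orthogonal to `W' = (ran P_a ⊓ (ℂχ_a)ᗮ) ⊔ (ran P̃_a ⊓ (ℂ𝓕⁻¹χ_a)ᗮ)`.
[cite: Burnol2004b, Prop. 4.5 with its second proof (arXiv:math/0203120v7 p. 9, TeX l.760–786)] -/
theorem exists_pair_sonineL_mod_sonineK {a : ℝ} (ha : 0 < a) :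
    ∃ u ∈ sonineL a, ∃ v ∈ sonineL a,
      (∀ c d : ℂ, c • u + d • v ∈ sonineK a → c = 0 ∧ d = 0) ∧
      ∀ f ∈ sonineL a, ∃ c d : ℂ, f - c • u - d • v ∈ sonineK a := by
  set χ : Lp ℂ 2 (volume : Measure ℝ) := indicatorConstLp 2
    (measurableSet_Icc : MeasurableSet (Icc (-a) a)) measure_Icc_lt_top.ne (1 : ℂ) with hχ
  set ψ : Lp ℂ 2 (volume : Measure ℝ) := (𝓕⁻ χ : Lp ℂ 2 (volume : Measure ℝ)) with hψ
  have hχP : χ ∈ (cutoffProj a).range := indicatorConstLp_mem_range_cutoffProj a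
  have hχ0 : χ ≠ 0 := indicatorConstLp_ne_zero ha
  have hRχ : Lp.compMeasurePreserving (fun s : ℝ ↦ -s)
      (Measure.measurePreserving_neg (volume : Measure ℝ)) χ = χ := compNeg_indicatorConstLp a
  have hχe : χ ∈ evenL2 := by
    have h := coeFn_compNeg (F := ℂ) χ
    rw [hRχ] at h
    show ∀ᵐ x : ℝ, (χ : ℝ → ℂ) (-x) = (χ : ℝ → ℂ) x
    filter_upwards [h] with x hx
    exact hx.symm
  have hψF : ψ = (𝓕 χ : Lp ℂ 2 (volume : Measure ℝ)) := by
    rw [hψ, fourierInv_eq_compNeg_fourier, compNeg_eq_self_of_mem_evenL2 (fourier_mem_evenL2 hχe)]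
  have hψe : ψ ∈ evenL2 := hψF ▸ fourier_mem_evenL2 hχe
  have hRψ : Lp.compMeasurePreserving (fun s : ℝ ↦ -s)
      (Measure.measurePreserving_neg (volume : Measure ℝ)) ψ = ψ := compNeg_eq_self_of_mem_evenL2 hψe
  have hψQ : ψ ∈ (cutoffProjHat a).range := by
    rw [mem_range_cutoffProjHat_iff, hψ, fourier_fourierInv_eq]; exact hχP
  have hψ0 : ψ ≠ 0 := by
    intro h0
    apply hχ0
    have : ‖χ‖ = 0 := by rw [← Lp.norm_fourier_eq χ, ← hψF, h0, norm_zero]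
    exact norm_eq_zero.1 this
  have hAB := range_cutoffProj_inf_range_cutoffProjHat a a
  have hcl : IsClosed (((cutoffProj a).range ⊓ (ℂ ∙ χ)ᗮ ⊔ (cutoffProjHat a).range ⊓ (ℂ ∙ ψ)ᗮ :
      Submodule ℂ (Lp ℂ 2 (volume : Measure ℝ))) : Set (Lp ℂ 2 (volume : Measure ℝ))) := by
    refine isClosed_sup_of_le_range (isStarProjection_cutoffProj a) (isStarProjection_cutoffProjHat a)
      (norm_cutoffProj_comp_cutoffProjHat_lt_one a a) inf_le_left inf_le_left ?_ ?_
    · rw [Submodule.coe_inf]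
      exact (ContinuousLinearMap.IsIdempotentElem.isClosed_range
        (isStarProjection_cutoffProj a).isIdempotentElem).inter (Submodule.isClosed_orthogonal _)
    · rw [Submodule.coe_inf]
      exact (ContinuousLinearMap.IsIdempotentElem.isClosed_range
        (isStarProjection_cutoffProjHat a).isIdempotentElem).inter (Submodule.isClosed_orthogonal _)
  obtain ⟨u, v, hu, hv, hχu, hψv, hind, hspan⟩ := exists_pair_of_codim_two hχP hψQ hχ0 hψ0 hAB hcl
  -- evenness of `u`, `v` by the reflection
  have hRperp : ∀ x ∈ ((cutoffProj a).range ⊓ (ℂ ∙ χ)ᗮ ⊔ (cutoffProjHat a).range ⊓ (ℂ ∙ ψ)ᗮ)ᗮ,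
      Lp.compMeasurePreserving (fun s : ℝ ↦ -s) (Measure.measurePreserving_neg (volume : Measure ℝ)) x ∈
        ((cutoffProj a).range ⊓ (ℂ ∙ χ)ᗮ ⊔ (cutoffProjHat a).range ⊓ (ℂ ∙ ψ)ᗮ)ᗮ :=
    fun x hx ↦ compNeg_mem_orthogonal_primed ha x hx
  have hRW' : ∀ x ∈ ((cutoffProj a).range ⊓ (ℂ ∙ χ)ᗮ ⊔ (cutoffProjHat a).range ⊓ (ℂ ∙ ψ)ᗮ),
      Lp.compMeasurePreserving (fun s : ℝ ↦ -s) (Measure.measurePreserving_neg (volume : Measure ℝ)) x ∈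
        ((cutoffProj a).range ⊓ (ℂ ∙ χ)ᗮ ⊔ (cutoffProjHat a).range ⊓ (ℂ ∙ ψ)ᗮ) :=
    fun x hx ↦ map_mem_of_isClosed_of_orthogonal inner_compNeg_left_eq hcl hRperp hx
  have hRu := map_eq_self_of_sub_mem hRW' hRperp hRχ hu hχu
  have hRv := map_eq_self_of_sub_mem hRW' hRperp hRψ hv hψv
  have hue : u ∈ evenPart := by
    have h := coeFn_compNeg (F := ℂ) u
    rw [hRu] at h
    rw [mem_evenPart_iff]
    filter_upwards [h] with x hx
    exact hx.symm
  have hve : v ∈ evenPart := by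
    have h := coeFn_compNeg (F := ℂ) v
    rw [hRv] at h
    rw [mem_evenPart_iff]
    filter_upwards [h] with x hx
    exact hx.symm
  refine ⟨u, ?_, v, ?_, ?_, ?_⟩
  · rw [sonineL_eq_inf_orthogonal ha, SetLike.mem_coe]
    exact Submodule.mem_inf.2 ⟨hue, hu⟩
  · rw [sonineL_eq_inf_orthogonal ha, SetLike.mem_coe]
    exact Submodule.mem_inf.2 ⟨hve, hv⟩
  · intro c d hcd
    rw [sonineK_eq_inf_orthogonal a, SetLike.mem_coe, Submodule.mem_inf] at hcd
    exact hind c d hcd.2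
  · intro f hf
    rw [sonineL_eq_inf_orthogonal ha, SetLike.mem_coe, Submodule.mem_inf] at hf
    obtain ⟨c, d, hcd⟩ := hspan f hf.2
    refine ⟨c, d, ?_⟩
    rw [sonineK_eq_inf_orthogonal a, SetLike.mem_coe, Submodule.mem_inf]
    exact ⟨evenPart.sub_mem (evenPart.sub_mem hf.1 (evenPart.smul_mem c hue))
      (evenPart.smul_mem d hve), hcd⟩

end ClauseDim


/-! ## Part 2. Lemma 4.4 via the Cesàro average (tools I–III, assembly IV) -/

section CesaroTools

/-! ### I. Substitution: `∫₀¹ v⁻¹ φ(c/v) dv = ∫_c^∞ φ(η) dη/η` -/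

/-- The change of variables `η = c/v` (`c > 0`): `∫_{0<v<1} v⁻¹ φ(c/v) dv = ∫_{η>c} η⁻¹ φ(η) dη`
(no integrability hypothesis: both sides are `0` together otherwise). [folklore] -/
private theorem integral_Ioo_inv_smul_comp_div {E : Type*} [NormedAddCommGroup E] [NormedSpace ℝ E]
    (φ : ℝ → E) {c : ℝ} (hc : 0 < c) :
    ∫ v in Ioo (0 : ℝ) 1, v⁻¹ • φ (c / v) = ∫ η in Ioi c, η⁻¹ • φ η := by
  -- step 1: the inversion `x ↦ x⁻¹` on `(0, ∞)`
  have h1 := integral_comp_rpow_Ioi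
    (fun y : ℝ ↦ (Ioi (1 : ℝ)).indicator (fun y : ℝ ↦ y⁻¹ • φ (c * y)) y) (p := -1) (by norm_num)
  have hL : (∫ x in Ioi (0 : ℝ), (|(-1 : ℝ)| * x ^ ((-1 : ℝ) - 1)) •
      (Ioi (1 : ℝ)).indicator (fun y : ℝ ↦ y⁻¹ • φ (c * y)) (x ^ (-1 : ℝ))) =
      ∫ v in Ioo (0 : ℝ) 1, v⁻¹ • φ (c / v) := by
    rw [← Ioi_inter_Iio, ← setIntegral_indicator measurableSet_Iio]
    refine setIntegral_congr_fun measurableSet_Ioi fun x hx ↦ ?_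
    have hx0 : (0 : ℝ) < x := hx
    rw [Real.rpow_neg_one, show ((-1 : ℝ) - 1) = -2 by norm_num, Real.rpow_neg hx0.le,
      Real.rpow_two, abs_neg, abs_one, one_mul]
    by_cases hx1 : x < 1
    · have hmem : x⁻¹ ∈ Ioi (1 : ℝ) := by
        rw [mem_Ioi]; exact one_lt_inv_iff₀.2 ⟨hx0, hx1⟩
      rw [indicator_of_mem hmem, indicator_of_mem (mem_Iio.2 hx1), inv_inv, smul_smul,
        ← div_eq_mul_inv c x]
      congr 1
      field_simp
    · have hnot : x⁻¹ ∉ Ioi (1 : ℝ) := by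
        rw [mem_Ioi, not_lt]
        exact inv_le_one_of_one_le₀ (not_lt.1 hx1)
      rw [indicator_of_notMem hnot, indicator_of_notMem (fun h : x ∈ Iio (1 : ℝ) ↦ hx1 h),
        smul_zero]
  have hR : (∫ y in Ioi (0 : ℝ), (Ioi (1 : ℝ)).indicator (fun y : ℝ ↦ y⁻¹ • φ (c * y)) y) =
      ∫ y in Ioi (1 : ℝ), y⁻¹ • φ (c * y) := by
    rw [setIntegral_indicator measurableSet_Ioi, Ioi_inter_Ioi, max_eq_right zero_le_one]
  rw [hL, hR] at h1
  rw [h1]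
  -- step 2: the dilation `η = c·y` on `(1, ∞)`
  have h2 := integral_comp_mul_left_Ioi (fun η : ℝ ↦ (c / η) • φ η) 1 hc
  have h2' : (fun y : ℝ ↦ (fun η : ℝ ↦ (c / η) • φ η) (c * y)) = fun y ↦ y⁻¹ • φ (c * y) := by
    funext y
    simp only
    by_cases hy : y = 0
    · rw [hy, mul_zero, inv_zero, div_zero]
    · rw [show c / (c * y) = y⁻¹ by field_simp]
  rw [h2'] at h2
  rw [h2, mul_one, ← integral_smul]
  refine setIntegral_congr_fun measurableSet_Ioi fun η hη ↦ ?_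
  have hη0 : (0 : ℝ) < η := hc.trans hη
  rw [smul_smul]
  congr 1
  field_simp

/-! ### II. The Cesàro average `t ↦ ∫₀¹ k(vt) dv` and its right Mellin transform -/

/-- The Cesàro average of a function vanishing on `(−∞, a]` (`a > 0`) vanishes at `t ≤ a`. [folklore] -/
private theorem cesaro_eq_zero_of_le {k : ℝ → ℂ} {a : ℝ} (ha : 0 < a) (hk0 : ∀ u, u ≤ a → k u = 0)
    {t : ℝ} (ht : t ≤ a) : ∫ v in Ioo (0 : ℝ) 1, k (v * t) = 0 := by
  refine setIntegral_eq_zero_of_forall_eq_zero fun v hv ↦ hk0 _ ?_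
  by_cases ht0 : 0 ≤ t
  · nlinarith [hv.1, hv.2]
  · nlinarith [hv.1, hv.2, not_le.1 ht0]

/-- **`(Qk)^(s) = k̂(s)/s`** for the Cesàro average `Qk(t) = ∫₀¹ k(vt)dv = t⁻¹∫₀ᵗ k` of a measurable
`k ∈ L²(ℝ)` vanishing on `(−∞, a]`, `a > 0`, on `Re s > ½`: absolute convergence and the value
(Fubini; `∫₀^∞ t^{−s} k(vt) dt = v^{s−1} k̂(s)`, `∫₀¹ v^{s−1} dv = 1/s`). This is the `t`-side of the
division by `s` in "if `F ∈ K̂_a` then `F(s)/s ∈ L̂_a`".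
[cite: Burnol2004b, Lemma 4.4 (arXiv:math/0203120v7 p. 8, TeX l.750–758)] -/
theorem rightMellin_cesaro {k : ℝ → ℂ} {a : ℝ} (ha : 0 < a) (hkm : Measurable k)
    (hk : MemLp k 2 volume) (hk0 : ∀ u, u ≤ a → k u = 0) {s : ℂ} (hs : 1 / 2 < s.re) :
    MellinConvergent (fun t : ℝ ↦ ∫ v in Ioo (0 : ℝ) 1, k (v * t)) (1 - s) ∧
      rightMellin (fun t : ℝ ↦ ∫ v in Ioo (0 : ℝ) 1, k (v * t)) s = rightMellin k s / s := by
  set μ : Measure ℝ := volume.restrict (Ioi (0 : ℝ)) with hμ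
  set ν : Measure ℝ := volume.restrict (Ioo (0 : ℝ) 1) with hν
  set σ : ℝ := s.re with hσ
  have hs0 : 0 < σ := by rw [hσ]; linarith
  have hsne : s ≠ 0 := by
    intro h; rw [hσ, h, Complex.zero_re] at hs0; exact lt_irrefl _ hs0
  -- the kernel
  set F : ℝ → ℝ → ℂ := fun t v ↦ (t : ℂ) ^ (1 - s - 1) • k (v * t) with hF
  have hFm : Measurable (Function.uncurry F) := by
    refine Measurable.smul ((Complex.measurable_ofReal.comp measurable_fst).pow_const _) ?_
    exact hkm.comp (measurable_snd.mul measurable_fst)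
  have hre : ((1 : ℂ) - s - 1).re = -σ := by
    rw [Complex.sub_re, Complex.sub_re, Complex.one_re, hσ]; ring
  -- sections in `v`
  have hsec : ∀ v ∈ Ioo (0 : ℝ) 1, Integrable (fun t ↦ F t v) μ := by
    intro v hv
    have hkv : MemLp (fun t : ℝ ↦ k (v * t)) 2 volume := memLp_comp_mul_left hk hv.1.ne'
    have hkv0 : ∀ u, u ≤ a / v → k (v * u) = 0 := by
      intro u hu
      apply hk0
      calc v * u ≤ v * (a / v) := mul_le_mul_of_nonneg_left hu hv.1.le
        _ = a := mul_div_cancel₀ a hv.1.ne'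
    exact TailFactor.mellinConvergent_of_memLp (div_pos ha hv.1) hkv hkv0 hs
  -- the norm of the sections
  set M : ℝ := ∫ u in Ioi (0 : ℝ), ‖k u‖ * u ^ (-σ) with hM
  have hnormF : ∀ v ∈ Ioo (0 : ℝ) 1, ∫ t, ‖F t v‖ ∂μ = v ^ (σ - 1) * M := by
    intro v hv
    have h2 : (fun t ↦ ‖F t v‖) =ᶠ[ae μ]
        fun t ↦ v ^ σ * ((fun u : ℝ ↦ ‖k u‖ * u ^ (-σ)) (v * t)) := by
      filter_upwards [ae_restrict_mem (μ := (volume : Measure ℝ)) measurableSet_Ioi] with t ht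
      have ht0 : (0 : ℝ) < t := ht
      rw [hF]
      dsimp only
      rw [norm_smul, Complex.norm_cpow_eq_rpow_re_of_pos ht0, hre, Real.mul_rpow hv.1.le ht0.le,
        Real.rpow_neg hv.1.le]
      have hvσ : v ^ σ ≠ 0 := (Real.rpow_pos_of_pos hv.1 σ).ne'
      field_simp
    rw [integral_congr_ae h2, integral_const_mul]
    have h3 : (∫ t, (fun u : ℝ ↦ ‖k u‖ * u ^ (-σ)) (v * t) ∂μ) =
        ∫ t in Ioi (0 : ℝ), (fun u : ℝ ↦ ‖k u‖ * u ^ (-σ)) (v * t) := rfl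
    rw [h3, integral_comp_mul_left_Ioi (fun u : ℝ ↦ ‖k u‖ * u ^ (-σ)) 0 hv.1, mul_zero,
      smul_eq_mul, ← hM, ← mul_assoc, Real.rpow_sub hv.1, Real.rpow_one, div_eq_mul_inv]
  -- integrability on the product
  have hFint : Integrable (Function.uncurry F) (μ.prod ν) := by
    rw [integrable_prod_iff' hFm.aestronglyMeasurable]
    refine ⟨(ae_restrict_iff' measurableSet_Ioo).2 (ae_of_all _ hsec), ?_⟩
    have hrpow : IntegrableOn (fun v : ℝ ↦ v ^ (σ - 1)) (Ioo (0 : ℝ) 1) :=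
      (intervalIntegral.integrableOn_Ioo_rpow_iff zero_lt_one).2 (by linarith)
    exact IntegrableOn.congr_fun (hrpow.mul_const M) (fun v hv ↦ (hnormF v hv).symm)
      measurableSet_Ioo
  have hswap := integral_integral_swap hFint
  -- the left side
  have hL : rightMellin (fun t : ℝ ↦ ∫ v in Ioo (0 : ℝ) 1, k (v * t)) s = ∫ t, ∫ v, F t v ∂ν ∂μ := by
    show (∫ t in Ioi (0 : ℝ), (t : ℂ) ^ (1 - s - 1) • ∫ v in Ioo (0 : ℝ) 1, k (v * t)) = _
    refine integral_congr_ae (ae_of_all _ fun t ↦ ?_)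
    exact (integral_smul _ _).symm
  -- the right side
  have hinner : ∀ v ∈ Ioo (0 : ℝ) 1, ∫ t, F t v ∂μ = (v : ℂ) ^ (s - 1) * rightMellin k s := by
    intro v hv
    show mellin (fun t ↦ k (v * t)) (1 - s) = _
    rw [mellin_comp_mul_left k (1 - s) hv.1, smul_eq_mul, neg_sub]
    rfl
  have hR : ∫ v, ∫ t, F t v ∂μ ∂ν = (∫ v in Ioo (0 : ℝ) 1, (v : ℂ) ^ (s - 1)) * rightMellin k s := by
    rw [← integral_mul_const]
    exact setIntegral_congr_fun measurableSet_Ioo fun v hv ↦ hinner v hv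
  have hcpow : ∫ v in Ioo (0 : ℝ) 1, (v : ℂ) ^ (s - 1) = 1 / s := by
    rw [← integral_Ioc_eq_integral_Ioo, ← intervalIntegral.integral_of_le zero_le_one,
      integral_cpow (Or.inl (by rw [Complex.sub_re, Complex.one_re]; linarith))]
    rw [sub_add_cancel, Complex.ofReal_one, Complex.one_cpow, Complex.ofReal_zero,
      Complex.zero_cpow hsne, sub_zero]
  refine ⟨?_, ?_⟩
  · have h := hFint.integral_prod_left
    refine h.congr (ae_of_all _ fun t ↦ ?_)
    show (∫ y, F t y ∂ν) = (t : ℂ) ^ (1 - s - 1) • ∫ v, k (v * t) ∂ν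
    exact integral_smul _ _
  · rw [hL, hswap, hR, hcpow, one_div, div_eq_inv_mul]

/-! ### III. The Fourier side: `⟨𝓕⁻¹α, Qf⟩ = 0` for mean-zero `α` supported in `[−a, a]` -/

/-- Pull-back of an a.e. equality along a dilation `x ↦ cx`, `c ≠ 0`. [folklore] -/
private theorem ae_eq_comp_mul_left {f g : ℝ → ℂ} (h : f =ᵐ[volume] g) {c : ℝ} (hc : c ≠ 0) :
    (fun x : ℝ ↦ f (c * x)) =ᵐ[volume] fun x ↦ g (c * x) :=
  ((measurePreserving_mul_left hc).quasiMeasurePreserving.mono_right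
    Measure.smul_absolutelyContinuous).ae_eq h

/-- **The Fourier side of Lemma 4.4.** Let `f ∈ L²(ℝ)` with a.e.-representative `f₀`, let `g₀` be an
even representative of `𝓕f` vanishing on `[−a, a]` (`a > 0`), let `H ∈ L²` be the class of the Cesàro
average `t ↦ ∫₀¹ f₀(vt) dv`, and let `α ∈ L²` be supported in `[−a, a]` with `∫ α = 0`. Then
`⟨𝓕⁻¹α, H⟩ = 0`. (Duality form of the intertwining `𝓕 ∘ Q = P ∘ 𝓕` of the Cesàro average `Q` with
the tail average `P`: `⟨𝓕⁻¹α, Qf⟩ = ∫₀¹ ⟨α, 𝓕(f(v·))⟩ dv = ∫₀¹ v⁻¹⟨α, (𝓕f)(·/v)⟩ dv =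
∫ ᾱ(ξ) ∫_{|ξ|}^∞ (𝓕f)(η) dη/η dξ`, and the inner integral is the constant `∫_a^∞ (𝓕f)(η)dη/η` on
`[−a, a]`.) [cite: Burnol2004b, Lemma 4.4 (arXiv:math/0203120v7 p. 8, TeX l.750–758)] -/
theorem inner_fourierInv_cesaro_eq_zero {a : ℝ} (f : Lp ℂ 2 (volume : Measure ℝ))
    {f₀ : ℝ → ℂ} (hf₀m : Measurable f₀) (hff₀ : (f : ℝ → ℂ) =ᵐ[volume] f₀)
    {g₀ : ℝ → ℂ} (hg₀m : Measurable g₀)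
    (hgg₀ : ((𝓕 f : Lp ℂ 2 (volume : Measure ℝ)) : ℝ → ℂ) =ᵐ[volume] g₀)
    (hg₀e : ∀ x, g₀ (-x) = g₀ x) (hg₀0 : ∀ x, |x| ≤ a → g₀ x = 0)
    (H : Lp ℂ 2 (volume : Measure ℝ))
    (hH : (H : ℝ → ℂ) =ᵐ[volume] fun t ↦ ∫ v in Ioo (0 : ℝ) 1, f₀ (v * t))
    {α : Lp ℂ 2 (volume : Measure ℝ)} (hα0 : ∀ᵐ ξ : ℝ, ξ ∉ Icc (-a) a → (α : ℝ → ℂ) ξ = 0)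
    (hαint : ∫ ξ, (α : ℝ → ℂ) ξ = 0) :
    ⟪(𝓕⁻ α : Lp ℂ 2 (volume : Measure ℝ)), H⟫_ℂ = 0 := by
  set m : Lp ℂ 2 (volume : Measure ℝ) := (𝓕⁻ α : Lp ℂ 2 (volume : Measure ℝ)) with hm
  set ν : Measure ℝ := volume.restrict (Ioo (0 : ℝ) 1) with hν
  have hf₀L : MemLp f₀ 2 volume := (Lp.memLp f).ae_eq hff₀
  have hg₀L : MemLp g₀ 2 volume := (Lp.memLp (𝓕 f : Lp ℂ 2 (volume : Measure ℝ))).ae_eq hgg₀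
  have hmm : Measurable (m : ℝ → ℂ) := (Lp.stronglyMeasurable m).measurable
  have hαm : Measurable (α : ℝ → ℂ) := (Lp.stronglyMeasurable α).measurable
  have hp : ENNReal.ofReal (2 : ℝ) = 2 := by norm_num
  have h22 : (2 : ℝ).HolderConjugate 2 := Real.HolderConjugate.two_two
  -- Step 1: `⟨m, H⟩` as an iterated integral
  have h1 : ⟪m, H⟫_ℂ = ∫ t, ∫ v, f₀ (v * t) * (starRingEnd ℂ) ((m : ℝ → ℂ) t) ∂ν := by
    rw [L2.inner_def]
    refine integral_congr_ae ?_
    filter_upwards [hH] with t ht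
    rw [RCLike.inner_apply, ht]
    exact (integral_mul_const _ _).symm
  -- Step 2: Fubini in `(t, v)`
  set G : ℝ → ℝ → ℂ := fun t v ↦ f₀ (v * t) * (starRingEnd ℂ) ((m : ℝ → ℂ) t) with hG
  have hGm : Measurable (Function.uncurry G) :=
    (hf₀m.comp (measurable_snd.mul measurable_fst)).mul
      (Complex.continuous_conj.measurable.comp (hmm.comp measurable_fst))
  have hdil : ∀ v : ℝ, v ≠ 0 → MemLp (fun t : ℝ ↦ f₀ (v * t)) 2 volume :=
    fun v hv ↦ memLp_comp_mul_left hf₀L hv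
  set A : ℝ := ∫ t, ‖f₀ t‖ ^ (2 : ℝ) with hA
  set B : ℝ := ∫ t, ‖(m : ℝ → ℂ) t‖ ^ (2 : ℝ) with hB
  have hA0 : 0 ≤ A := integral_nonneg fun t ↦ by positivity
  have hGnorm : ∀ v t : ℝ, ‖G t v‖ = ‖f₀ (v * t)‖ * ‖(m : ℝ → ℂ) t‖ := by
    intro v t
    rw [hG]
    dsimp only
    rw [norm_mul, RCLike.norm_conj]
  have hsecG : ∀ v : ℝ, v ≠ 0 → Integrable (fun t ↦ G t v) volume := by
    intro v hv
    have h := ((hdil v hv).norm).integrable_mul (Lp.memLp m).norm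
    refine h.mono' (hGm.comp (measurable_id.prodMk measurable_const)).aestronglyMeasurable
      (ae_of_all _ fun t ↦ ?_)
    exact (hGnorm v t).le
  have hboundG : ∀ v : ℝ, 0 < v →
      ∫ t, ‖G t v‖ ≤ v ^ (-(1 / 2 : ℝ)) * (A ^ (1 / 2 : ℝ) * B ^ (1 / 2 : ℝ)) := by
    intro v hv
    have hf' : MemLp (fun t : ℝ ↦ f₀ (v * t)) (ENNReal.ofReal 2) volume := by
      rw [hp]; exact hdil v hv.ne'
    have hm' : MemLp (m : ℝ → ℂ) (ENNReal.ofReal 2) volume := by rw [hp]; exact Lp.memLp m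
    have h := integral_mul_norm_le_Lp_mul_Lq h22 hf' hm'
    have hG' : (fun t ↦ ‖G t v‖) = fun t ↦ ‖f₀ (v * t)‖ * ‖(m : ℝ → ℂ) t‖ := funext (hGnorm v)
    rw [hG']
    refine h.trans (le_of_eq ?_)
    have hsub : ∫ t, ‖f₀ (v * t)‖ ^ (2 : ℝ) = v⁻¹ * A := by
      rw [hA, show (∫ t, ‖f₀ (v * t)‖ ^ (2 : ℝ)) =
          ∫ t, (fun u : ℝ ↦ ‖f₀ u‖ ^ (2 : ℝ)) (v * t) from rfl,
        Measure.integral_comp_mul_left (fun u : ℝ ↦ ‖f₀ u‖ ^ (2 : ℝ)) v, smul_eq_mul,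
        abs_of_pos (inv_pos.2 hv)]
    rw [hsub, ← hB, Real.mul_rpow (inv_pos.2 hv).le hA0, Real.inv_rpow hv.le, Real.rpow_neg hv.le,
      mul_assoc]
  have hGint : Integrable (Function.uncurry G) ((volume : Measure ℝ).prod ν) := by
    rw [integrable_prod_iff' hGm.aestronglyMeasurable]
    refine ⟨(ae_restrict_iff' measurableSet_Ioo).2 (ae_of_all _ fun v hv ↦ hsecG v hv.1.ne'), ?_⟩
    have hmeas : AEStronglyMeasurable
        (fun v ↦ ∫ t, ‖Function.uncurry G (t, v)‖ ∂(volume : Measure ℝ)) ν :=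
      (hGm.stronglyMeasurable.norm.integral_prod_left').aestronglyMeasurable
    have hdom : IntegrableOn
        (fun v : ℝ ↦ v ^ (-(1 / 2 : ℝ)) * (A ^ (1 / 2 : ℝ) * B ^ (1 / 2 : ℝ))) (Ioo (0 : ℝ) 1) :=
      ((intervalIntegral.integrableOn_Ioo_rpow_iff zero_lt_one).2 (by norm_num)).mul_const _
    refine hdom.mono' hmeas ?_
    filter_upwards [ae_restrict_mem (μ := (volume : Measure ℝ)) measurableSet_Ioo] with v hv
    rw [Real.norm_eq_abs, abs_of_nonneg (integral_nonneg fun t ↦ norm_nonneg _)]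
    exact hboundG v hv.1
  have hswap := integral_integral_swap hGint
  -- Step 3: the `t`-integral for fixed `v`: Parseval and the dilation law
  have h3 : ∀ v ∈ Ioo (0 : ℝ) 1, ∫ t, G t v =
      ((v⁻¹ : ℝ) : ℂ) * ∫ ξ, g₀ (v⁻¹ * ξ) * (starRingEnd ℂ) ((α : ℝ → ℂ) ξ) := by
    intro v hv
    have hv0 : v ≠ 0 := hv.1.ne'
    set d : Lp ℂ 2 (volume : Measure ℝ) := (memLp_comp_mul_left (Lp.memLp f) hv0).toLp _ with hd
    have hdco : (d : ℝ → ℂ) =ᵐ[volume] fun t ↦ f₀ (v * t) :=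
      (coeFn_toLp_comp_mul_left f hv0).trans (ae_eq_comp_mul_left hff₀ hv0)
    have e1 : ∫ t, G t v = ⟪m, d⟫_ℂ := by
      rw [L2.inner_def]
      refine integral_congr_ae ?_
      filter_upwards [hdco] with t ht
      rw [RCLike.inner_apply, ht]
    have e2 : ⟪m, d⟫_ℂ = ⟪α, (𝓕 d : Lp ℂ 2 (volume : Measure ℝ))⟫_ℂ := (inner_fourier_right α d).symm
    set d' : Lp ℂ 2 (volume : Measure ℝ) :=
      (memLp_comp_mul_left (Lp.memLp (𝓕 f : Lp ℂ 2 (volume : Measure ℝ))) (inv_ne_zero hv0)).toLp _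
      with hd'
    have e3 : (𝓕 d : Lp ℂ 2 (volume : Measure ℝ)) = |v|⁻¹ • d' := fourier_toLp_comp_mul_left f hv0
    have hd'co : (d' : ℝ → ℂ) =ᵐ[volume] fun ξ ↦ g₀ (v⁻¹ * ξ) :=
      (coeFn_toLp_comp_mul_left (𝓕 f : Lp ℂ 2 (volume : Measure ℝ)) (inv_ne_zero hv0)).trans
        (ae_eq_comp_mul_left hgg₀ (inv_ne_zero hv0))
    have e4 : ⟪α, d'⟫_ℂ = ∫ ξ, g₀ (v⁻¹ * ξ) * (starRingEnd ℂ) ((α : ℝ → ℂ) ξ) := by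
      rw [L2.inner_def]
      refine integral_congr_ae ?_
      filter_upwards [hd'co] with ξ hξ
      rw [RCLike.inner_apply, hξ]
    rw [e1, e2, e3, RCLike.real_smul_eq_coe_smul (K := ℂ), inner_smul_right, e4, abs_of_pos hv.1]
    rfl
  -- Step 4: Fubini in `(v, ξ)`
  set K : ℝ → ℝ → ℂ := fun v ξ ↦
    ((v⁻¹ : ℝ) : ℂ) * (g₀ (v⁻¹ * ξ) * (starRingEnd ℂ) ((α : ℝ → ℂ) ξ)) with hK
  have hKm : Measurable (Function.uncurry K) := by
    refine Measurable.mul (Complex.measurable_ofReal.comp measurable_fst.inv) ?_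
    exact (hg₀m.comp (measurable_fst.inv.mul measurable_snd)).mul
      (Complex.continuous_conj.measurable.comp (hαm.comp measurable_snd))
  have h4 : ∀ v ∈ Ioo (0 : ℝ) 1, ∫ t, G t v = ∫ ξ, K v ξ := by
    intro v hv
    rw [h3 v hv, ← integral_const_mul]
  set C : ℝ := ∫ ξ, ‖g₀ ξ‖ ^ (2 : ℝ) with hC
  set D : ℝ := ∫ ξ, ‖(α : ℝ → ℂ) ξ‖ ^ (2 : ℝ) with hD
  have hC0 : 0 ≤ C := integral_nonneg fun _ ↦ by positivity
  have hdil' : ∀ v : ℝ, v ≠ 0 → MemLp (fun ξ : ℝ ↦ g₀ (v⁻¹ * ξ)) 2 volume :=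
    fun v hv ↦ memLp_comp_mul_left hg₀L (inv_ne_zero hv)
  have hKnorm : ∀ v : ℝ, 0 < v → ∀ ξ : ℝ,
      ‖K v ξ‖ = v⁻¹ * (‖g₀ (v⁻¹ * ξ)‖ * ‖(α : ℝ → ℂ) ξ‖) := by
    intro v hv ξ
    rw [hK]
    dsimp only
    rw [norm_mul, norm_mul, RCLike.norm_conj, Complex.norm_real, Real.norm_eq_abs,
      abs_of_pos (inv_pos.2 hv)]
  have hsecK : ∀ v : ℝ, 0 < v → Integrable (fun ξ ↦ K v ξ) volume := by
    intro v hv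
    have h := (((hdil' v hv.ne').norm).integrable_mul (Lp.memLp α).norm).const_mul (v⁻¹)
    refine h.mono' (hKm.comp (measurable_const.prodMk measurable_id)).aestronglyMeasurable
      (ae_of_all _ fun ξ ↦ ?_)
    exact (hKnorm v hv ξ).le
  have hboundK : ∀ v : ℝ, 0 < v →
      ∫ ξ, ‖K v ξ‖ ≤ v ^ (-(1 / 2 : ℝ)) * (C ^ (1 / 2 : ℝ) * D ^ (1 / 2 : ℝ)) := by
    intro v hv
    have hg' : MemLp (fun ξ : ℝ ↦ g₀ (v⁻¹ * ξ)) (ENNReal.ofReal 2) volume := by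
      rw [hp]; exact hdil' v hv.ne'
    have hα' : MemLp (α : ℝ → ℂ) (ENNReal.ofReal 2) volume := by rw [hp]; exact Lp.memLp α
    have h := integral_mul_norm_le_Lp_mul_Lq h22 hg' hα'
    have hK' : (fun ξ ↦ ‖K v ξ‖) = fun ξ ↦ v⁻¹ * (‖g₀ (v⁻¹ * ξ)‖ * ‖(α : ℝ → ℂ) ξ‖) :=
      funext (hKnorm v hv)
    rw [hK', integral_const_mul]
    have hsub : ∫ ξ, ‖g₀ (v⁻¹ * ξ)‖ ^ (2 : ℝ) = v * C := by
      rw [hC, show (∫ ξ, ‖g₀ (v⁻¹ * ξ)‖ ^ (2 : ℝ)) =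
          ∫ ξ, (fun u : ℝ ↦ ‖g₀ u‖ ^ (2 : ℝ)) (v⁻¹ * ξ) from rfl,
        Measure.integral_comp_inv_mul_left (fun u : ℝ ↦ ‖g₀ u‖ ^ (2 : ℝ)) v, smul_eq_mul,
        abs_of_pos hv]
    rw [hsub, ← hD] at h
    calc v⁻¹ * ∫ ξ, ‖g₀ (v⁻¹ * ξ)‖ * ‖(α : ℝ → ℂ) ξ‖
        ≤ v⁻¹ * ((v * C) ^ (1 / 2 : ℝ) * D ^ (1 / 2 : ℝ)) :=
          mul_le_mul_of_nonneg_left h (inv_pos.2 hv).le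
      _ = v ^ (-(1 / 2 : ℝ)) * (C ^ (1 / 2 : ℝ) * D ^ (1 / 2 : ℝ)) := by
          rw [Real.mul_rpow hv.le hC0, show v⁻¹ = v ^ (-1 : ℝ) from (Real.rpow_neg_one v).symm,
            show -(1 / 2 : ℝ) = -1 + 1 / 2 by norm_num, Real.rpow_add hv]
          ring
  have hKint : Integrable (Function.uncurry K) (ν.prod (volume : Measure ℝ)) := by
    rw [integrable_prod_iff hKm.aestronglyMeasurable]
    refine ⟨(ae_restrict_iff' measurableSet_Ioo).2 (ae_of_all _ fun v hv ↦ hsecK v hv.1), ?_⟩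
    have hmeas : AEStronglyMeasurable
        (fun v ↦ ∫ ξ, ‖Function.uncurry K (v, ξ)‖ ∂(volume : Measure ℝ)) ν :=
      (hKm.stronglyMeasurable.norm.integral_prod_right').aestronglyMeasurable
    have hdom : IntegrableOn
        (fun v : ℝ ↦ v ^ (-(1 / 2 : ℝ)) * (C ^ (1 / 2 : ℝ) * D ^ (1 / 2 : ℝ))) (Ioo (0 : ℝ) 1) :=
      ((intervalIntegral.integrableOn_Ioo_rpow_iff zero_lt_one).2 (by norm_num)).mul_const _
    refine hdom.mono' hmeas ?_
    filter_upwards [ae_restrict_mem (μ := (volume : Measure ℝ)) measurableSet_Ioo] with v hv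
    rw [Real.norm_eq_abs, abs_of_nonneg (integral_nonneg fun t ↦ norm_nonneg _)]
    exact hboundK v hv.1
  have hswap2 := integral_integral_swap hKint
  -- Step 5: the `v`-integral is the constant `∫_a^∞ g₀(η) dη/η` on `[−a, a] ∖ {0}`
  set C₀ : ℂ := ∫ η in Ioi a, (η⁻¹ : ℝ) • g₀ η with hC₀
  have hT : ∀ ξ : ℝ, ξ ≠ 0 → |ξ| ≤ a →
      ∫ v in Ioo (0 : ℝ) 1, ((v⁻¹ : ℝ) : ℂ) * g₀ (v⁻¹ * ξ) = C₀ := by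
    intro ξ hξ0 hξa
    have hξ : 0 < |ξ| := abs_pos.2 hξ0
    have e1 : (fun v : ℝ ↦ ((v⁻¹ : ℝ) : ℂ) * g₀ (v⁻¹ * ξ)) = fun v ↦ v⁻¹ • g₀ (|ξ| / v) := by
      funext v
      rw [Complex.real_smul]
      congr 1
      rcases le_or_gt 0 ξ with h | h
      · rw [abs_of_nonneg h, div_eq_inv_mul]
      · rw [abs_of_neg h, neg_div, hg₀e, div_eq_inv_mul]
    rw [e1, integral_Ioo_inv_smul_comp_div g₀ hξ, hC₀, ← integral_indicator measurableSet_Ioi,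
      ← integral_indicator measurableSet_Ioi]
    refine integral_congr_ae (ae_of_all _ fun η ↦ ?_)
    by_cases h1 : η ∈ Ioi a
    · rw [indicator_of_mem h1, indicator_of_mem (show η ∈ Ioi |ξ| from lt_of_le_of_lt hξa h1)]
    · rw [indicator_of_notMem h1]
      by_cases h2 : η ∈ Ioi |ξ|
      · rw [indicator_of_mem h2, hg₀0 η, smul_zero]
        rw [abs_of_pos (hξ.trans h2)]
        exact not_lt.1 h1
      · rw [indicator_of_notMem h2]
  -- Step 6: conclusion
  have hpt : ∀ᵐ ξ : ℝ, ξ ∉ ({0} : Set ℝ) := compl_mem_ae_iff.mpr (measure_singleton 0)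
  have h6 : ∀ᵐ ξ : ℝ, ∫ v, K v ξ ∂ν = C₀ * (starRingEnd ℂ) ((α : ℝ → ℂ) ξ) := by
    filter_upwards [hα0, hpt] with ξ hαξ hξ0
    have hξ0' : ξ ≠ 0 := fun h ↦ hξ0 (mem_singleton_iff.2 h)
    have eK : ∫ v, K v ξ ∂ν =
        (∫ v in Ioo (0 : ℝ) 1, ((v⁻¹ : ℝ) : ℂ) * g₀ (v⁻¹ * ξ)) * (starRingEnd ℂ) ((α : ℝ → ℂ) ξ) := by
      rw [← integral_mul_const]
      refine integral_congr_ae (ae_of_all _ fun v ↦ ?_)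
      rw [hK]
      dsimp only
      ring
    rw [eK]
    by_cases hξa : ξ ∈ Icc (-a) a
    · rw [hT ξ hξ0' (abs_le.2 ⟨hξa.1, hξa.2⟩)]
    · rw [hαξ hξa, map_zero, mul_zero, mul_zero]
  have h45 : ∫ v, ∫ t, G t v ∂(volume : Measure ℝ) ∂ν = ∫ v, ∫ ξ, K v ξ ∂(volume : Measure ℝ) ∂ν :=
    setIntegral_congr_fun measurableSet_Ioo fun v hv ↦ h4 v hv
  calc ⟪m, H⟫_ℂ = ∫ t, ∫ v, G t v ∂ν := h1
    _ = ∫ v, ∫ t, G t v ∂(volume : Measure ℝ) ∂ν := hswap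
    _ = ∫ v, ∫ ξ, K v ξ ∂(volume : Measure ℝ) ∂ν := h45
    _ = ∫ ξ, ∫ v, K v ξ ∂ν := hswap2
    _ = ∫ ξ, C₀ * (starRingEnd ℂ) ((α : ℝ → ℂ) ξ) := integral_congr_ae h6
    _ = C₀ * (starRingEnd ℂ) (∫ ξ, (α : ℝ → ℂ) ξ) := by rw [integral_const_mul, integral_conj]
    _ = 0 := by rw [hαint, map_zero, mul_zero]

end CesaroTools

section LemmaFourFour

/-! ### IV. Lemma 4.4: `F ∈ K̂_a ⇒ F(s)/s ∈ L̂_a` — the witness is the Cesàro average `Qf` -/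

/-- An even `L²` class vanishing a.e. on `(0,a)` has an everywhere even, measurable representative
vanishing on `[−a, a]`. [folklore] -/
private theorem exists_even_rep {a : ℝ} {u : Lp ℂ 2 (volume : Measure ℝ)} (hue : u ∈ evenL2)
    (hu0 : ∀ᵐ x : ℝ, x ∈ Ioo 0 a → (u : ℝ → ℂ) x = 0) :
    ∃ u₀ : ℝ → ℂ, Measurable u₀ ∧ (u : ℝ → ℂ) =ᵐ[volume] u₀ ∧ (∀ x, u₀ (-x) = u₀ x) ∧
      ∀ x, |x| ≤ a → u₀ x = 0 := by
  refine ⟨fun x ↦ (Ioi a).indicator (u : ℝ → ℂ) |x|, ?_, ?_, ?_, ?_⟩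
  · exact ((Lp.stronglyMeasurable u).measurable.indicator measurableSet_Ioi).comp
      continuous_abs.measurable
  · have hneg : Measure.QuasiMeasurePreserving (fun x : ℝ ↦ -x) volume volume :=
      (Measure.measurePreserving_neg (volume : Measure ℝ)).quasiMeasurePreserving
    have hue' : ∀ᵐ x : ℝ, (u : ℝ → ℂ) (-x) = (u : ℝ → ℂ) x := hue
    have hnull : ∀ᵐ x : ℝ, x ∉ ({-a, 0, a} : Set ℝ) :=
      compl_mem_ae_iff.mpr ((Set.toFinite _).measure_zero volume)
    filter_upwards [hue', hu0, hneg.ae hu0, hnull] with x he h0 h0' hx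
    simp only [mem_insert_iff, mem_singleton_iff, not_or] at hx
    show (u : ℝ → ℂ) x = (Ioi a).indicator (u : ℝ → ℂ) |x|
    by_cases hxa : a < |x|
    · rw [indicator_of_mem (mem_Ioi.2 hxa)]
      rcases le_or_gt 0 x with hx0 | hx0
      · rw [abs_of_nonneg hx0]
      · rw [abs_of_neg hx0, he]
    · rw [indicator_of_notMem (fun h : |x| ∈ Ioi a ↦ hxa h)]
      have hne : |x| ≠ a := by
        rcases le_or_gt 0 x with h | h
        · rw [abs_of_nonneg h]; exact hx.2.2
        · rw [abs_of_neg h]; intro h'; exact hx.1 (by linarith)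
      have hlt : |x| < a := lt_of_le_of_ne (not_lt.1 hxa) hne
      rcases lt_trichotomy x 0 with hx0 | hx0 | hx0
      · rw [← he]
        refine h0' ⟨by linarith, ?_⟩
        rw [abs_of_neg hx0] at hlt
        exact hlt
      · exact absurd hx0 hx.2.1
      · rw [abs_of_pos hx0] at hlt
        exact h0 ⟨hx0, hlt⟩
  · intro x
    show (Ioi a).indicator (u : ℝ → ℂ) |-x| = (Ioi a).indicator (u : ℝ → ℂ) |x|
    rw [abs_neg]
  · intro x hx
    exact indicator_of_notMem (fun h : |x| ∈ Ioi a ↦ not_lt.2 hx h) _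

/-- The Cesàro average of a measurable function is measurable. [folklore] -/
private theorem measurable_cesaro {f₀ : ℝ → ℂ} (hf₀m : Measurable f₀) :
    Measurable fun t : ℝ ↦ ∫ v in Ioo (0 : ℝ) 1, f₀ (v * t) := by
  have h : StronglyMeasurable (Function.uncurry fun t v : ℝ ↦ f₀ (v * t)) :=
    (hf₀m.comp (measurable_snd.mul measurable_fst)).stronglyMeasurable
  exact (h.integral_prod_right (ν := volume.restrict (Ioo (0 : ℝ) 1))).measurable

/-- The Cesàro average of an even function is even. [folklore] -/
private theorem cesaro_even {f₀ : ℝ → ℂ} (hf₀e : ∀ x, f₀ (-x) = f₀ x) (t : ℝ) :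
    (∫ v in Ioo (0 : ℝ) 1, f₀ (v * -t)) = ∫ v in Ioo (0 : ℝ) 1, f₀ (v * t) := by
  simp_rw [mul_neg, hf₀e]

/-- The Cesàro average of a function vanishing on `[−a, a]` vanishes there. [folklore] -/
private theorem cesaro_eq_zero_of_abs_le {a : ℝ} {f₀ : ℝ → ℂ} (hf₀0 : ∀ x, |x| ≤ a → f₀ x = 0)
    {t : ℝ} (ht : |t| ≤ a) : ∫ v in Ioo (0 : ℝ) 1, f₀ (v * t) = 0 := by
  refine setIntegral_eq_zero_of_forall_eq_zero fun v hv ↦ hf₀0 _ ?_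
  rw [abs_mul, abs_of_pos hv.1]
  exact (mul_le_of_le_one_left (abs_nonneg t) hv.2.le).trans ht

/-- The Cesàro average as `t⁻¹ ∫₀ᵗ` for `t > 0`. [folklore] -/
private theorem cesaro_eq_inv_mul {f₀ : ℝ → ℂ} {t : ℝ} (ht : 0 < t) :
    (∫ v in Ioo (0 : ℝ) 1, f₀ (v * t)) = ((t : ℝ) : ℂ)⁻¹ * ∫ u in Ioo 0 t, f₀ u := by
  rw [← integral_Ioc_eq_integral_Ioo, ← intervalIntegral.integral_of_le zero_le_one,
    intervalIntegral.integral_comp_mul_right (fun u ↦ f₀ u) ht.ne', zero_mul, one_mul,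
    intervalIntegral.integral_of_le ht.le, integral_Ioc_eq_integral_Ioo, Complex.real_smul,
    Complex.ofReal_inv]

/-- **`Qf ∈ L²`** for the Cesàro average of an even `f₀ ∈ L²` (Hardy's inequality on `(0,∞)`,
`Literature/Analysis/FunctionSpaces/HardyInequalityAverage.lean`, and evenness).
[cite: HardyLittlewoodPolya1952, Thm. 327] -/
private theorem memLp_cesaro {f₀ : ℝ → ℂ} (hf₀m : Measurable f₀) (hf₀L : MemLp f₀ 2 volume)
    (hf₀e : ∀ x, f₀ (-x) = f₀ x) :
    MemLp (fun t : ℝ ↦ ∫ v in Ioo (0 : ℝ) 1, f₀ (v * t)) 2 volume := by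
  have hHm := measurable_cesaro hf₀m
  obtain ⟨-, hI, -⟩ :=
    Literature.Analysis.FunctionSpaces.hardy_average_norm_sq_integral_le hf₀m (hf₀L.restrict _)
  -- on `(0, ∞)`
  have hIoi : IntegrableOn (fun t : ℝ ↦ ‖∫ v in Ioo (0 : ℝ) 1, f₀ (v * t)‖ ^ 2) (Ioi 0) := by
    refine hI.congr_fun (fun t ht ↦ ?_) measurableSet_Ioi
    rw [cesaro_eq_inv_mul ht]
  -- on `(−∞, 0]` by evenness
  have hIci : IntegrableOn (fun t : ℝ ↦ ‖∫ v in Ioo (0 : ℝ) 1, f₀ (v * t)‖ ^ 2) (Ici 0) :=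
    (integrableOn_Ici_iff_integrableOn_Ioi enorm_ne_top).2 hIoi
  have hIic : IntegrableOn (fun t : ℝ ↦ ‖∫ v in Ioo (0 : ℝ) 1, f₀ (v * t)‖ ^ 2) (Iic 0) := by
    have h := ((Measure.measurePreserving_neg (volume : Measure ℝ)).integrableOn_comp_preimage
      (Homeomorph.neg ℝ).measurableEmbedding).2 hIci
    have hsub : Iic (0 : ℝ) ⊆ (fun x : ℝ ↦ -x) ⁻¹' (Ici (0 : ℝ)) := fun x hx ↦ by
      simp only [mem_preimage, mem_Ici, neg_nonneg]
      exact hx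
    refine (h.mono_set hsub).congr_fun (fun t _ ↦ ?_) measurableSet_Iic
    show ‖∫ v in Ioo (0 : ℝ) 1, f₀ (v * -t)‖ ^ 2 = ‖∫ v in Ioo (0 : ℝ) 1, f₀ (v * t)‖ ^ 2
    rw [cesaro_even hf₀e]
  have hint : Integrable (fun t : ℝ ↦ ‖∫ v in Ioo (0 : ℝ) 1, f₀ (v * t)‖ ^ 2) volume := by
    have h := hIic.union hIoi
    rwa [Iic_union_Ioi, integrableOn_univ] at h
  exact (memLp_two_iff_integrable_sq_norm hHm.aestronglyMeasurable).2 hint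

/-- **Lemma 4.4 (the witness): for `f ∈ K_a` (`a > 0`) the Cesàro average `h = Qf`,
`(Qf)(t) = |t|⁻¹∫₀^{|t|} f`, lies in `L_a` and `ĥ(s) = f̂(s)/s` on `½ < Re s < 1`.** (`h` is even,
vanishes on `(−a, a)`, is in `L²` by Hardy's inequality, `ĥ = f̂/s` by Fubini, and `𝓕h` is constant
on `(−a, a)`: `h ⊥ ran P̃_a ⊓ (ℂ𝓕⁻¹𝟙)ᗮ` by the Fourier-side computation
`inner_fourierInv_cesaro_eq_zero`.) Printed: "If `F(s)` belongs to `K̂_a` then `F(s)/s` belongs to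
`L̂_a`." [cite: Burnol2004b, Lemma 4.4 (arXiv:math/0203120v7 p. 8, TeX l.750–758)] -/
theorem exists_cesaro_mem_sonineL {a : ℝ} (ha : 0 < a) {f : Lp ℂ 2 (volume : Measure ℝ)}
    (hf : f ∈ sonineK a) :
    ∃ h ∈ sonineL a, ∀ s : ℂ, 1 / 2 < s.re → s.re < 1 →
      rightMellin (h : ℝ → ℂ) s = rightMellin (f : ℝ → ℂ) s / s := by
  obtain ⟨hfe, hfz, hFz⟩ := hf
  obtain ⟨f₀, hf₀m, hff₀, hf₀e, hf₀0⟩ := exists_even_rep hfe hfz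
  obtain ⟨g₀, hg₀m, hgg₀, hg₀e, hg₀0⟩ := exists_even_rep (fourier_mem_evenL2 hfe) hFz
  have hf₀L : MemLp f₀ 2 volume := (Lp.memLp f).ae_eq hff₀
  have hHL : MemLp (fun t : ℝ ↦ ∫ v in Ioo (0 : ℝ) 1, f₀ (v * t)) 2 volume :=
    memLp_cesaro hf₀m hf₀L hf₀e
  set hL : Lp ℂ 2 (volume : Measure ℝ) := hHL.toLp _ with hhL
  have hco : (hL : ℝ → ℂ) =ᵐ[volume] fun t ↦ ∫ v in Ioo (0 : ℝ) 1, f₀ (v * t) := hHL.coeFn_toLp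
  refine ⟨hL, ?_, ?_⟩
  · rw [sonineL_eq_inf_orthogonal ha, SetLike.mem_coe, Submodule.mem_inf, ← Submodule.inf_orthogonal,
      Submodule.mem_inf]
    refine ⟨?_, ?_, ?_⟩
    · -- `h` is even
      have hneg : Measure.QuasiMeasurePreserving (fun x : ℝ ↦ -x) volume volume :=
        (Measure.measurePreserving_neg (volume : Measure ℝ)).quasiMeasurePreserving
      rw [mem_evenPart_iff]
      filter_upwards [hco, hneg.ae hco] with x h1 h2
      rw [h2, h1]
      exact cesaro_even hf₀e x
    · -- `h ⊥ ran P_a ⊓ (ℂχ_a)ᗮ`: `h` vanishes on `[−a, a]`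
      rw [Submodule.mem_orthogonal]
      intro α hα
      have hαP := mem_range_cutoffProj_iff.1 (Submodule.mem_inf.1 hα).1
      rw [L2.inner_def]
      refine integral_eq_zero_of_ae ?_
      filter_upwards [hαP, hco] with t h1 h2
      rw [Pi.zero_apply]
      by_cases ht : t ∈ Icc (-a) a
      · rw [h2, cesaro_eq_zero_of_abs_le hf₀0 (abs_le.2 ⟨ht.1, ht.2⟩), inner_zero_right]
      · rw [h1 ht, inner_zero_left]
    · -- `h ⊥ ran P̃_a ⊓ (ℂ𝓕⁻¹χ_a)ᗮ`: the Fourier side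
      rw [Submodule.mem_orthogonal]
      intro β hβ
      obtain ⟨hβQ, hβψ⟩ := Submodule.mem_inf.1 hβ
      have hβQ' := mem_range_cutoffProj_iff.1 (mem_range_cutoffProjHat_iff.1 hβQ)
      rw [Submodule.mem_orthogonal_singleton_iff_inner_right] at hβψ
      have hαint : ∫ ξ, ((𝓕 β : Lp ℂ 2 (volume : Measure ℝ)) : ℝ → ℂ) ξ = 0 := by
        rw [← inner_indicatorConstLp_eq_integral le_rfl (mem_range_cutoffProjHat_iff.1 hβQ),
          inner_fourier_right]
        exact hβψ
      have h := inner_fourierInv_cesaro_eq_zero f hf₀m hff₀ hg₀m hgg₀ hg₀e hg₀0 hL hco hβQ' hαint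
      rwa [fourierInv_fourier_eq] at h
  · -- the Mellin identity
    intro s hs _
    set fp : ℝ → ℂ := (Ioi (0 : ℝ)).indicator f₀ with hfp
    have hfpm : Measurable fp := hf₀m.indicator measurableSet_Ioi
    have hfpL : MemLp fp 2 volume := hf₀L.indicator measurableSet_Ioi
    have hfp0 : ∀ u, u ≤ a → fp u = 0 := by
      intro u hu
      by_cases hu0 : u ∈ Ioi (0 : ℝ)
      · rw [hfp, indicator_of_mem hu0]
        refine hf₀0 u ?_
        rw [abs_of_pos (mem_Ioi.1 hu0)]
        exact hu
      · rw [hfp, indicator_of_notMem hu0]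
    obtain ⟨-, hM⟩ := rightMellin_cesaro ha hfpm hfpL hfp0 hs
    have e1 : rightMellin (hL : ℝ → ℂ) s =
        rightMellin (fun t : ℝ ↦ ∫ v in Ioo (0 : ℝ) 1, fp (v * t)) s := by
      show (∫ t in Ioi (0 : ℝ), (t : ℂ) ^ (1 - s - 1) • (hL : ℝ → ℂ) t) =
        ∫ t in Ioi (0 : ℝ), (t : ℂ) ^ (1 - s - 1) • ∫ v in Ioo (0 : ℝ) 1, fp (v * t)
      refine setIntegral_congr_ae measurableSet_Ioi ?_
      filter_upwards [hco] with t ht hpos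
      rw [ht]
      congr 1
      refine setIntegral_congr_fun measurableSet_Ioo fun v hv ↦ ?_
      rw [hfp, indicator_of_mem (mem_Ioi.2 (mul_pos hv.1 hpos))]
    have e2 : rightMellin (f : ℝ → ℂ) s = rightMellin fp s := by
      show (∫ t in Ioi (0 : ℝ), (t : ℂ) ^ (1 - s - 1) • (f : ℝ → ℂ) t) =
        ∫ t in Ioi (0 : ℝ), (t : ℂ) ^ (1 - s - 1) • fp t
      refine setIntegral_congr_ae measurableSet_Ioi ?_
      filter_upwards [hff₀] with t ht hpos
      rw [ht, hfp, indicator_of_mem (mem_Ioi.2 hpos)]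
    rw [e1, hM, e2]

end LemmaFourFour


/-! ### V. Towards Prop. 4.3 (division by `s − w`): the twisted Cesàro average `Q_w` -/

section TwistedCesaro

/-- **`(Q_w k)^(s) = k̂(s)/(s − w)`** for the TWISTED Cesàro average
`(Q_w k)(t) = ∫₀¹ v^{−w} k(vt) dv = t^{w−1}∫₀ᵗ u^{−w}k(u)du` of a measurable `k ∈ L²(ℝ)` vanishing on
`(−∞, a]`, `a > 0`, on `Re s > max(½, Re w)`: absolute convergence and the value (Fubini;
`∫₀^∞ t^{−s}k(vt)dt = v^{s−1}k̂(s)`, `∫₀¹ v^{s−1−w}dv = 1/(s−w)`). This is the `t`-side of the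
division by `s − w` in Prop. 4.3 ("`G(s)/(s−w)` again belongs to `L̂_a`").
[cite: Burnol2004b, Prop. 4.3 (arXiv:math/0203120v7 p. 8, TeX l.711–731)] -/
theorem rightMellin_cesaro_cpow {k : ℝ → ℂ} {a : ℝ} (ha : 0 < a) (hkm : Measurable k)
    (hk : MemLp k 2 volume) (hk0 : ∀ u, u ≤ a → k u = 0) {s w : ℂ} (hs : 1 / 2 < s.re)
    (hsw : w.re < s.re) :
    MellinConvergent (fun t : ℝ ↦ ∫ v in Ioo (0 : ℝ) 1, (v : ℂ) ^ (-w) * k (v * t)) (1 - s) ∧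
      rightMellin (fun t : ℝ ↦ ∫ v in Ioo (0 : ℝ) 1, (v : ℂ) ^ (-w) * k (v * t)) s =
        rightMellin k s / (s - w) := by
  set μ : Measure ℝ := volume.restrict (Ioi (0 : ℝ)) with hμ
  set ν : Measure ℝ := volume.restrict (Ioo (0 : ℝ) 1) with hν
  set σ : ℝ := s.re with hσ
  have hsw0 : 0 < σ - w.re := by rw [hσ]; linarith
  have hswne : s - w ≠ 0 := by
    intro h
    have := congrArg Complex.re h
    rw [Complex.sub_re, Complex.zero_re] at this
    linarith
  -- the kernel
  set F : ℝ → ℝ → ℂ := fun t v ↦ (t : ℂ) ^ (1 - s - 1) • ((v : ℂ) ^ (-w) * k (v * t)) with hF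
  have hFm : Measurable (Function.uncurry F) := by
    refine Measurable.smul ((Complex.measurable_ofReal.comp measurable_fst).pow_const _) ?_
    exact ((Complex.measurable_ofReal.comp measurable_snd).pow_const _).mul
      (hkm.comp (measurable_snd.mul measurable_fst))
  have hre : ((1 : ℂ) - s - 1).re = -σ := by
    rw [Complex.sub_re, Complex.sub_re, Complex.one_re, hσ]; ring
  -- sections in `v`
  have hsec : ∀ v ∈ Ioo (0 : ℝ) 1, Integrable (fun t ↦ F t v) μ := by
    intro v hv
    have hkv : MemLp (fun t : ℝ ↦ k (v * t)) 2 volume := memLp_comp_mul_left hk hv.1.ne'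
    have hkv0 : ∀ u, u ≤ a / v → k (v * u) = 0 := by
      intro u hu
      apply hk0
      calc v * u ≤ v * (a / v) := mul_le_mul_of_nonneg_left hu hv.1.le
        _ = a := mul_div_cancel₀ a hv.1.ne'
    have h := TailFactor.mellinConvergent_of_memLp (div_pos ha hv.1) hkv hkv0 hs
    have h' := h.const_mul ((v : ℂ) ^ (-w))
    refine h'.congr (ae_of_all _ fun t ↦ ?_)
    show (v : ℂ) ^ (-w) * ((t : ℂ) ^ (1 - s - 1) • k (v * t)) = F t v
    rw [hF]
    simp only [smul_eq_mul]
    ring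
  -- the norm of the sections
  set M : ℝ := ∫ u in Ioi (0 : ℝ), ‖k u‖ * u ^ (-σ) with hM
  have hnormF : ∀ v ∈ Ioo (0 : ℝ) 1, ∫ t, ‖F t v‖ ∂μ = v ^ (σ - w.re - 1) * M := by
    intro v hv
    have h2 : (fun t ↦ ‖F t v‖) =ᶠ[ae μ]
        fun t ↦ v ^ (σ - w.re) * ((fun u : ℝ ↦ ‖k u‖ * u ^ (-σ)) (v * t)) := by
      filter_upwards [ae_restrict_mem (μ := (volume : Measure ℝ)) measurableSet_Ioi] with t ht
      have ht0 : (0 : ℝ) < t := ht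
      rw [hF]
      dsimp only
      rw [norm_smul, norm_mul, Complex.norm_cpow_eq_rpow_re_of_pos ht0, hre,
        Complex.norm_cpow_eq_rpow_re_of_pos hv.1, Complex.neg_re, Real.mul_rpow hv.1.le ht0.le,
        Real.rpow_neg hv.1.le σ, Real.rpow_sub hv.1, Real.rpow_neg hv.1.le w.re]
      have hvσ : v ^ σ ≠ 0 := (Real.rpow_pos_of_pos hv.1 σ).ne'
      have hvw : v ^ w.re ≠ 0 := (Real.rpow_pos_of_pos hv.1 w.re).ne'
      field_simp
    rw [integral_congr_ae h2, integral_const_mul]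
    have h3 : (∫ t, (fun u : ℝ ↦ ‖k u‖ * u ^ (-σ)) (v * t) ∂μ) =
        ∫ t in Ioi (0 : ℝ), (fun u : ℝ ↦ ‖k u‖ * u ^ (-σ)) (v * t) := rfl
    rw [h3, integral_comp_mul_left_Ioi (fun u : ℝ ↦ ‖k u‖ * u ^ (-σ)) 0 hv.1, mul_zero,
      smul_eq_mul, ← hM, ← mul_assoc, Real.rpow_sub hv.1 (σ - w.re) 1, Real.rpow_one,
      div_eq_mul_inv]
  -- integrability on the product
  have hFint : Integrable (Function.uncurry F) (μ.prod ν) := by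
    rw [integrable_prod_iff' hFm.aestronglyMeasurable]
    refine ⟨(ae_restrict_iff' measurableSet_Ioo).2 (ae_of_all _ hsec), ?_⟩
    have hrpow : IntegrableOn (fun v : ℝ ↦ v ^ (σ - w.re - 1)) (Ioo (0 : ℝ) 1) :=
      (intervalIntegral.integrableOn_Ioo_rpow_iff zero_lt_one).2 (by linarith)
    exact IntegrableOn.congr_fun (hrpow.mul_const M) (fun v hv ↦ (hnormF v hv).symm)
      measurableSet_Ioo
  have hswap := integral_integral_swap hFint
  -- the left side
  have hL : rightMellin (fun t : ℝ ↦ ∫ v in Ioo (0 : ℝ) 1, (v : ℂ) ^ (-w) * k (v * t)) s =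
      ∫ t, ∫ v, F t v ∂ν ∂μ := by
    show (∫ t in Ioi (0 : ℝ), (t : ℂ) ^ (1 - s - 1) •
      ∫ v in Ioo (0 : ℝ) 1, (v : ℂ) ^ (-w) * k (v * t)) = _
    refine integral_congr_ae (ae_of_all _ fun t ↦ ?_)
    exact (integral_smul _ _).symm
  -- the right side
  have hinner : ∀ v ∈ Ioo (0 : ℝ) 1, ∫ t, F t v ∂μ = (v : ℂ) ^ (s - 1 - w) * rightMellin k s := by
    intro v hv
    have e : ∫ t, F t v ∂μ = (v : ℂ) ^ (-w) * mellin (fun t ↦ k (v * t)) (1 - s) := by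
      show ∫ t, F t v ∂μ = (v : ℂ) ^ (-w) * ∫ t in Ioi (0 : ℝ), (t : ℂ) ^ (1 - s - 1) • k (v * t)
      rw [← integral_const_mul]
      refine integral_congr_ae (ae_of_all _ fun t ↦ ?_)
      show F t v = (v : ℂ) ^ (-w) * ((t : ℂ) ^ (1 - s - 1) • k (v * t))
      rw [hF]
      simp only [smul_eq_mul]
      ring
    rw [e, mellin_comp_mul_left k (1 - s) hv.1, smul_eq_mul, neg_sub, ← mul_assoc,
      ← Complex.cpow_add _ _ (Complex.ofReal_ne_zero.2 hv.1.ne')]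
    show (v : ℂ) ^ (-w + (s - 1)) * mellin k (1 - s) = (v : ℂ) ^ (s - 1 - w) * mellin k (1 - s)
    rw [show -w + (s - 1) = s - 1 - w by ring]
  have hR : ∫ v, ∫ t, F t v ∂μ ∂ν =
      (∫ v in Ioo (0 : ℝ) 1, (v : ℂ) ^ (s - 1 - w)) * rightMellin k s := by
    rw [← integral_mul_const]
    exact setIntegral_congr_fun measurableSet_Ioo fun v hv ↦ hinner v hv
  have hcpow : ∫ v in Ioo (0 : ℝ) 1, (v : ℂ) ^ (s - 1 - w) = 1 / (s - w) := by
    rw [← integral_Ioc_eq_integral_Ioo, ← intervalIntegral.integral_of_le zero_le_one,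
      integral_cpow (Or.inl (by rw [Complex.sub_re, Complex.sub_re, Complex.one_re]; linarith))]
    rw [show s - 1 - w + 1 = s - w by ring, Complex.ofReal_one, Complex.one_cpow, Complex.ofReal_zero,
      Complex.zero_cpow hswne, sub_zero]
  refine ⟨?_, ?_⟩
  · have h := hFint.integral_prod_left
    refine h.congr (ae_of_all _ fun t ↦ ?_)
    show (∫ y, F t y ∂ν) = (t : ℂ) ^ (1 - s - 1) • ∫ v, (v : ℂ) ^ (-w) * k (v * t) ∂ν
    exact integral_smul _ _
  · rw [hL, hswap, hR, hcpow, one_div, div_eq_inv_mul]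

end TwistedCesaro

/-! ### G. The discharges -/

/-- **Prop. 4.6 holds**: for `a > 0`, `⋃_{b>a} K_b` is dense in `K_a` and `⋃_{b>a} L_b` is dense in
`L_a`. [cite: Burnol2004b, Prop. 4.6 (arXiv:math/0203120v7 p. 9, TeX l.790–804)] -/
theorem Burnol2004b_prop4_6_holds : Burnol2004b_prop4_6 :=
  fun a ha ↦ ⟨sonineK_subset_closure_iUnion a, sonineL_subset_closure_iUnion ha⟩

/-- **Prop. 4.5 holds**: `dim (L_a/K_a) = 2` for `a > 0` (two vectors of `L_a` independent modulo `K_a`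
and spanning `L_a` together with `K_a`). [cite: Burnol2004b, Prop. 4.5 (arXiv:math/0203120v7 p. 9, TeX l.760–786)] -/
theorem Burnol2004b_prop4_5_holds : Burnol2004b_prop4_5 :=
  fun _ ha ↦ exists_pair_sonineL_mod_sonineK ha

/-- **Lemma 4.4 holds**: for `a > 0` and `f ∈ K_a` there is `h ∈ L_a` (the Cesàro average of `f`)
with `ĥ(s) = f̂(s)/s` on `½ < Re s < 1`. [cite: Burnol2004b, Lemma 4.4 (arXiv:math/0203120v7 p. 8, TeX l.750–758)] -/
theorem Burnol2004b_lemma4_4_holds : Burnol2004b_lemma4_4 :=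
  fun _ ha _ hf ↦ exists_cesaro_mem_sonineL ha hf

end Literature.NumberTheory.LFunctions
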